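import Mathlib.Analysis.SpecialFunctions.Integrals.PosLogEqCircleAverage
import Mathlib.Analysis.SpecialFunctions.Trigonometric.Bounds
import Mathlib.Analysis.SpecialFunctions.Complex.Log
import Mathlib.Analysis.Complex.ExponentialBounds
import Mathlib.RingTheory.RootsOfUnity.Complex
import Mathlib.FieldTheory.KummerExtension
import Mathlib.RingTheory.Polynomial.Cyclotomic.Roots
import Mathlib.MeasureTheory.Integral.IntervalIntegral.Periodic
import Mathlib.MeasureTheory.Measure.Typeclasses.NullSingletonClass
import Mathlib.NumberTheory.Real.Irrational
import Mathlib.Analysis.Fourier.AddCircle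
import Mathlib.NumberTheory.ZetaValues
import Literature.NumberTheory.LFunctions.AmorosoCyclotomicCriterion
import Literature.NumberTheory.LFunctions.FareyFranelSummation
import Literature.NumberTheory.LFunctions.QuasiRHFactsProofs
import Literature.NumberTheory.LFunctions.LittlewoodCriterion
import Literature.NumberTheory.LFunctions.NymanBeurling
import HarnessLib

/-!
# RH-EQUIVALENT · Amoroso's cyclotomic criteria PROVED as equivalences: `Amoroso1996_thm_1_3_holds` (RH ⟺ `h̃(Φ₁⋯Φ_N) ≪_ε N^{1/2+ε}`, Amoroso 1996 Thm 1.3) and `Amoroso1995_criterion_holds` (Broughan Vol. 2 Thm 7.6 = Bordellès Thm 3.55: for `1/2 < λ < 1`, `h̃(A_N) ≪_ε N^{λ+ε}` ⟺ `ζ ≠ 0` on `Re s > λ`) — discharges of the two named facts of `AmorosoCyclotomicCriterion.lean`, plus the RH-FREE lower bound `|M(N)| ≤ 4 h̃(A_N)` and (§10, gen-11 append) `Amoroso1995_derivative_criterion_holds` (Broughan Vol. 2 Thm 7.7, the ONE-SIDED derivative criterion, PROVED); nothing here bears on the truth of RH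

Literature-typing tranche `rh-lit-broughan-2` (Broughan, *Equivalents of the Riemann Hypothesis*
Vol. 2, Ch. 7 "Cyclotomic Polynomials", Thm 7.6; the volume is NOT held), gen 11. This file turns the
two named facts

* `Literature.NumberTheory.LFunctions.Amoroso1996_thm_1_3` (F. Amoroso, *Algebraic numbers close
  to 1 and variants of Mahler's measure*, J. Number Theory 60 (1996) 80–96, **Thm 1.3**), and
* `Literature.NumberTheory.LFunctions.Amoroso1995_criterion` (Amoroso, Rend. Sem. Mat. Univ.
  Politec. Torino 53 (1995); printed as Bordellès, *Arithmetic Tales* (2020) **Thm 3.55** and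
  Broughan Vol. 2 **Thm 7.6**, the "Amoroso criterion")

into KERNEL EQUIVALENCES (`Amoroso1996_thm_1_3_holds`, `Amoroso1995_criterion_holds`; standard
axioms), where `h̃(P) = (1/2π) ∫₀^{2π} log⁺|P(e^{it})| dt` is `posLogMahlerMeasure` and
`A_N = Φ₁⋯Φ_N = cyclotomicProduct N`.

## The printed argument (Amoroso 1996, §3 and §5) and how it is followed

Amoroso writes `Φ = A_N = ∏_{m ≤ N} (z^m − 1)^{M(N/m)}` (`M` the Mertens function), so that
(5.1) `log|Φ(e^{it})| = ∑_{m ≤ N} M(N/m) u(mt)` with `u(t) = log|1 − e^{it}|`, and, the zeros of `Φ`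
lying on the unit circle, `∫₀^{2π} log|Φ(e^{it})| dt = 0`, whence `∫₀^{2π} |log|Φ(e^{it})|| dt = 4π·h̃(Φ)`
(§3). Lower bound (Prop. 3.1, (5.2)): `∫₀^{2π} u(nt) cos νt dt` vanishes unless `n ∣ ν`, so the first
Fourier coefficient of `log|Φ(e^{it})|` is `−π M(N)`, giving `|M(N)| ≤ 4 h̃(Φ)`; with
Littlewood's theorem (`M(x) ≪ x^{λ+ε}` ⟺ `ζ ≠ 0` on `Re s > λ`, Titchmarsh Thm 14.25/14.26) this is the half
"`h̃ ≪ N^{λ+ε}` ⟹ zero-free". Upper bound ((5.3)): Amoroso bounds `‖log|Φ|‖_{L^p}`, `p > 1`, through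
the CONJUGATE function `π ψ(t/2π)` of `log|Φ(e^{it})|` (`ψ` = the Farey/sawtooth discrepancy sum
`∑ M(N/m) B̄₁(m·)`), M. Riesz's theorem and Huxley's `L^p` Franel estimate. DEVIATION (shorter road,
same mathematics at `p = 2`): we bound `‖log|Φ|‖_{L¹} ≤ ‖log|Φ|‖_{L²}` and evaluate the `L²` norm
EXACTLY by Edwards' real-variable computation of Franel's Gram matrix (tree
`FareyFranelSummation.lean`, Edwards §12.2), transported from `B̄₁` to `u`: with `v(x) = u(2πx)`,
`J_{ab} = ∫₀¹ v(ax)v(bx) dx = (a,b)² J₁₁/(ab)` (coprime reduction by the substitution `x ↦ ax`,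
periodicity, and the root-of-unity identity `∑_{k<a} v(x + bk/a) = v(ax)` for `(a,b) = 1`, which is
`∏_{k<a} (X − ζ^{-k}) = X^a − 1`), hence `∫₀¹ (log|Φ(e(x))|)² dx = ∑∑ M(N/a)M(N/b)(a,b)² J₁₁/(ab)
≤ J₁₁ C² N^{2s} (1 + log N)³` under `|M(y)| ≤ C y^s` (`s ≥ 1/2`; Edwards' double sum
`∑∑ (a,b)²(ab)^{−3/2} ≤ (1 + log N)³`, tree `FareyFranel.sum_sum_gcd_sq_w32_le`). This is Parseval for
the conjugate pair (`‖log|Φ|‖₂ = π‖ψ‖₂`) done without Fourier series; M. Riesz's theorem is not needed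
at `p = 2`, and the value `J₁₁ = π²/12` is not needed for the criteria (only `J₁₁ < ∞`, i.e.
`u ∈ L²`); it is computed in §11, which makes the `L²` identity `‖log|Φ|‖₂ = π‖ψ‖₂` explicit.

## Contents (namespace `Literature.NumberTheory.LFunctions.AmorosoProofs` for the machinery)

* §0 `circ x = e(x) = exp(2πix)`, `vlog x = log‖e(x) − 1‖ = log(2|sin πx|)` (Amoroso's `u` in the
  variable `t = 2πx`): periodicity, `e(x) = 1 ⟺ x ∈ ℤ`, measurability; irrational `x` (a.e.) as the
  generic parameters (`e(x)` not a root of unity).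
* §1 `vlog ∈ L²_loc` (`(log s)² ≤ 16 s^{−1/2}`, Jordan's inequality; majorant
  `1 + 8(x^{−1/2} + (1−x)^{−1/2})`), products of dilates locally integrable.
* §2 `sum_vlog_add_mul_div`: `∑_{k<a} v(x + bk/a) = v(ax)` for `(a,b) = 1`, irrational `x`.
* §3 `J a b`, `J_eq`: `J_{ab} = (a,b)² J₁₁/(ab)`.
* §4 `gsum N x = ∑_{k≤N} M(N/k) v(kx)`; `integral_gsum_sq` (the Gram-matrix evaluation) and
  `integral_gsum_sq_le` (the bound under `|M(y)| ≤ C y^s`).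
* §5 `log_norm_eval_cyclotomicProduct`: `log|A_N(e(x))| = gsum N x` for irrational `x` (cyclotomic
  Möbius inversion `log|Φ_n(z)| = ∑_{ab=n} μ(a) log|z^b − 1|` and Dirichlet's rearrangement,
  Mathlib `ArithmeticFunction.sum_eq_iff_sum_mul_moebius_eq`, `sum_Ioc_mul_eq_sum_sum`).
* §6 `circleAverage_eq_integral_circ`; `logMahlerMeasure_cyclotomicProduct` (`m(A_N) = 0`, Mathlib's
  `logMahlerMeasure_eq_log_leadingCoeff_add_sum_log_roots`); `posLogMahlerMeasure_cyclotomicProduct_eq`: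
  **`h̃(A_N) = ½ ∫₀¹ |gsum N|`**.
* §7 `integral_vlog_mul_cos` (`∫₀¹ v(x)cos 2πx dx = −1/2`, by parts through the continuous
  `sin(2πx) log(2 sin πx)`), `integral_vlog_natMul_mul_cos` (`= 0` for dilates `k ≥ 2`, vanishing sum of
  `k`-th roots of unity), `integral_gsum_mul_cos` (`= −M(N)/2`), and the RH-FREE
  **`abs_mertensFunction_le_four_mul_posLogMahlerMeasure`**: `|M(N)| ≤ 4 h̃(A_N)` (Amoroso (5.2)).
* §8 `sq_integral_abs_le_integral_sq` (Cauchy–Schwarz in variance form),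
  `posLogMahlerMeasure_isBigO_of_mertens_isBigO`: `M ≪_ε x^{θ+ε}` ⟹ `h̃(A_N) ≪_ε N^{θ+ε}` (`θ ≥ 1/2`).
* §9 assembly with the tree's PROVED Mertens dictionary (`mertens_isBigO_of_quasiRiemannHypothesis_holds`,
  `quasiRiemannHypothesis_of_mertens_isBigO_holds`, Titchmarsh Thm 14.25):
  `posLogMahlerMeasure_isBigO_of_zeroFree`, `mertens_isBigO_of_posLogMahlerMeasure_isBigO`,
  `zeroFree_of_posLogMahlerMeasure_isBigO`; then, in `Literature.NumberTheory.LFunctions`: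
  `posLogMahlerMeasure_isBigO_iff_forall_riemannZeta_ne_zero` (the criterion on the CLOSED range
  `1/2 ≤ λ < 1`), **`Amoroso1995_criterion_holds`**, **`Amoroso1996_thm_1_3_holds`**,
  `riemannHypothesis_iff_posLogMahlerMeasure_cyclotomicProduct_isBigO`,
  `logMahlerMeasure_cyclotomicProduct_eq_zero`.

* §10 (append) Broughan Vol. 2 **Thm 7.7** / the named fact `Amoroso1995_derivative_criterion`
  (ONE-SIDED): `rootSet N` (the roots of `A_N`), `cyclotomicProduct_eq_nodal`, the Lagrange lower bound
  `inv_norm_eval_le` (`1/|A_N(z)| ≤ e^L ∑_μ 1/|z − μ|` from Mathlib's first barycentric form),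
  `integral_glog_le` (`∫₀¹ log⁺(1/(K|e(x) − 1|)) dx ≤ 4/√K`), `posLogMahlerMeasure_le_of_derivative_criterion`
  (`h̃(A_N) ≤ (|C| + 16) N^λ`), **`Amoroso1995_derivative_criterion_holds`** and
  `riemannHypothesis_of_cyclotomicProduct_derivative_bound` (λ = 1/2: the derivative bound implies RH).
  The 1995 source is not held: the route (interpolation + the easy half of Thm 7.6) is ours; the
  statement is the printed one. Net debt −1 more (−3 for the file).

* §11 (append) the exact constant and the Amoroso ⟷ Franel bridge: `fourierCoeffOn_vlog` (the Fourier
  coefficients `−1/(2|n|)` of `v` on `[0,1]`, from §7 and the dilation identity of §2), `J_one_one_eq`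
  (**`J₁₁ = π²/12`**, Parseval `tsum_sq_fourierCoeffOn` + `hasSum_zeta_two`; the second higher Mahler
  measure `m₂(x − 1) = ζ(2)/2` of Kurokawa–Lalín–Ochiai), `integral_sq_log_norm_cyclotomicProduct_eq`
  (Amoroso's conjugate-function identity in `L²` form: `∫₀¹ log²|A_N(e(x))| dx = π² ∫₀¹ G_N²`, `G_N`
  Franel's function `∑_{k≤N} M(N/k) B̄₁(kx)` of the tree file `FareyFranelSummation.lean`) and
  `posLogMahlerMeasure_sq_le_franel` (**`h̃(A_N)² ≤ (π²/4)(A(N) ∑_ν δ_ν² + 1/12)`**, the cross-row link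
  from the cyclotomic row (Broughan Vol. 2 Ch. 7) to the Farey/Franel row (Vol. 1 / Edwards §12.2)).
  No new definitions, no new named facts.

SHAPE (splitting books): ASYMPTOTIC (`∀ ε`, `O`-statement in `N`; no finite part); σ-INDEXED on
`[1/2, 1)`. No new definitions of notions (the helper `def`s `circ`, `vlog`, `J`, `gsum`, `vlogArith` are
proof plumbing), no new named facts; net debt −2.

## Sources

* [Amoroso1996] F. Amoroso, J. Number Theory 60 (1996) 80–96, §3 (Prop. 3.1, "`∫|log|R(e^{it})|| dt =
  4h̃(R)`"), §5 ((5.1)–(5.3), Thm 1.3) — held [corpus:paper:doi-10-1006-jnth-1996-0114] (extraction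
  loses the displays; the prose of §3/§5 fixes the architecture followed here).
* [Bordelles2020ArithmeticTales] Thm 3.55 (statement of the σ-indexed form; held scan).
* [Broughan2017] Vol. 2 Thm 7.6 p. 117 (not held; Cambridge Core first-page preview, gen 3).
* [Edwards1974] §12.2 (Franel's `I_{ab}`, `∫₀¹ G_N² = A ∑ δ_ν² + 1/12`), through the tree file
  `FareyFranelSummation.lean`.
* [KurokawaLalinOchiai2009] N. Kurokawa, M. Lalín, H. Ochiai, *Higher Mahler measures and zeta
  functions*, Acta Arith. 135 (2008) 269–297, §1 / §3 Examples 5 (`m₂(1 − x) = ζ(2)/2 = π²/12`) — held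
  [corpus:paper:arxiv-0908.0171 p.2, p.4].
* [Titchmarsh1986] Thm 14.25 (Littlewood), through `LittlewoodCriterion.lean` / `QuasiRHFactsProofs.lean`.
-/

noncomputable section

open scoped Real
open MeasureTheory intervalIntegral Finset Filter Asymptotics Polynomial

namespace Literature.NumberTheory.LFunctions

namespace AmorosoProofs

/-! ### §0. The unit-circle parametrisation `e(x) = exp(2πix)` and Amoroso's `u` in the variable `x`:
`v(x) = log |e(x) − 1| = log(2|sin πx|)` -/

/-- `e(x) = exp(2πix)`. [cite: Amoroso1996, §3 (the parametrisation `R(e^{it})`, `t = 2πx`)] -/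
def circ (x : ℝ) : ℂ := Complex.exp (2 * π * Complex.I * x)

/-- Amoroso's `u(t) = log|1 − e^{it}|` in the variable `t = 2πx`: `v(x) = log ‖e(x) − 1‖`.
[cite: Amoroso1996, §5 (the function `u(t) = log|1 − e^{it}|`)] -/
def vlog (x : ℝ) : ℝ := Real.log ‖circ x - 1‖

/-- `|e(x)| = 1`. [folklore] -/
private theorem norm_circ (x : ℝ) : ‖circ x‖ = 1 := by
  unfold circ
  rw [show (2 * π * Complex.I * x : ℂ) = ((2 * π * x : ℝ) : ℂ) * Complex.I by push_cast; ring]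
  exact Complex.norm_exp_ofReal_mul_I _

/-- `e(x + y) = e(x) e(y)`. [folklore] -/
private theorem circ_add (x y : ℝ) : circ (x + y) = circ x * circ y := by
  unfold circ; rw [← Complex.exp_add]; congr 1; push_cast; ring

/-- `e(m) = 1` for `m ∈ ℤ`. [folklore] -/
private theorem circ_int (m : ℤ) : circ m = 1 := by
  unfold circ
  rw [show (2 * π * Complex.I * ((m : ℝ) : ℂ) : ℂ) = (m : ℂ) * (2 * π * Complex.I) by push_cast; ring]
  exact Complex.exp_int_mul_two_pi_mul_I m

/-- `e` is `1`-periodic (integer shifts). [folklore] -/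
private theorem circ_add_int (x : ℝ) (m : ℤ) : circ (x + m) = circ x := by
  rw [circ_add, circ_int, mul_one]

/-- `e` is `1`-periodic (natural shifts). [folklore] -/
private theorem circ_add_nat (x : ℝ) (m : ℕ) : circ (x + m) = circ x := by
  have h := circ_add_int x (m : ℤ)
  rwa [Int.cast_natCast] at h

/-- `e(nx) = e(x)^n`. [folklore] -/
private theorem circ_nat_mul (n : ℕ) (x : ℝ) : circ (n * x) = circ x ^ n := by
  unfold circ
  rw [← Complex.exp_nat_mul]; congr 1; push_cast; ring

/-- `e(x) = 1 ⟺ x ∈ ℤ`. [folklore] -/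
private theorem circ_eq_one_iff (x : ℝ) : circ x = 1 ↔ ∃ m : ℤ, x = m := by
  constructor
  · intro h
    unfold circ at h
    rw [Complex.exp_eq_one_iff] at h
    obtain ⟨m, hm⟩ := h
    refine ⟨m, ?_⟩
    have h2 : (2 * π * Complex.I : ℂ) ≠ 0 := by simp [Real.pi_ne_zero, Complex.I_ne_zero]
    have : (x : ℂ) = (m : ℂ) := by
      rw [mul_comm (m : ℂ)] at hm
      exact mul_left_cancel₀ h2 hm
    exact_mod_cast this
  · rintro ⟨m, rfl⟩
    exact circ_int m

/-- `|e(x) − 1| = 2|sin πx|`. [folklore] -/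
private theorem norm_circ_sub_one (x : ℝ) : ‖circ x - 1‖ = 2 * |Real.sin (π * x)| := by
  unfold circ
  rw [show (2 * π * Complex.I * x : ℂ) = Complex.I * ((2 * π * x : ℝ) : ℂ) by push_cast; ring,
    Complex.norm_exp_I_mul_ofReal_sub_one, Real.norm_eq_abs, abs_mul, abs_two,
    show 2 * π * x / 2 = π * x by ring]

/-- `v(x) = log(2|sin πx|)`. [folklore] -/
private theorem vlog_eq_log_sin (x : ℝ) : vlog x = Real.log (2 * |Real.sin (π * x)|) := by
  rw [vlog, norm_circ_sub_one]

/-- `v` is `1`-periodic (integer shifts). [folklore] -/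
private theorem vlog_add_int (x : ℝ) (m : ℤ) : vlog (x + m) = vlog x := by
  rw [vlog, vlog, circ_add_int]

/-- `v` is `1`-periodic (natural shifts). [folklore] -/
private theorem vlog_add_nat (x : ℝ) (m : ℕ) : vlog (x + m) = vlog x := by
  rw [vlog, vlog, circ_add_nat]

/-- `v` is `1`-periodic. [folklore] -/
private theorem vlog_periodic : Function.Periodic vlog 1 := fun x => by
  simpa using vlog_add_int x 1

/-- `v(0) = 0` (Mathlib's `log 0 = 0`). [folklore] -/
private theorem vlog_zero : vlog 0 = 0 := by simp [vlog, circ]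

/-- `v(m) = 0` for `m ∈ ℤ`. [folklore] -/
private theorem vlog_int (m : ℤ) : vlog m = 0 := by
  rw [vlog, circ_int]; simp

/-- `v` is measurable. [folklore] -/
private theorem measurable_vlog : Measurable vlog := by
  unfold vlog circ
  exact Real.measurable_log.comp (Continuous.measurable (by fun_prop))

/-! ### Generic points: irrational `x`, i.e. `e(x)` not a root of unity (a co-countable, hence
full-measure, set of parameters; all pointwise identities below hold there) -/

/-- Almost every real number is irrational (the rationals are countable). [folklore] -/
private theorem ae_irrational : ∀ᵐ x : ℝ, Irrational x := by
  have hS : (Set.range ((↑) : ℚ → ℝ)).Countable := Set.countable_range _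
  have h0 := hS.measure_zero volume
  rw [measure_eq_zero_iff_ae_notMem] at h0
  exact h0

/-- For irrational `x`, `n x ∉ ℤ` for `n ≥ 1`. [folklore] -/
private theorem natMul_ne_intCast_of_irrational {x : ℝ} (hx : Irrational x) {n : ℕ} (hn : 1 ≤ n) (m : ℤ) :
    (n : ℝ) * x ≠ m := by
  intro h
  have hn0 : (n : ℝ) ≠ 0 := by positivity
  refine hx ⟨(m : ℚ) / n, ?_⟩
  push_cast
  rw [div_eq_iff hn0, ← h, mul_comm]

/-- `e(nx) ≠ 1` for irrational `x`, `n ≥ 1`. [folklore] -/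
private theorem circ_nat_mul_ne_one_of_irrational {x : ℝ} (hx : Irrational x) {n : ℕ} (hn : 1 ≤ n) :
    circ (n * x) ≠ 1 := by
  rw [Ne, circ_eq_one_iff]
  rintro ⟨m, hm⟩
  exact natMul_ne_intCast_of_irrational hx hn m hm

/-- `e(x)^n ≠ 1` for irrational `x`, `n ≥ 1`. [folklore] -/
private theorem circ_pow_ne_one_of_irrational {x : ℝ} (hx : Irrational x) {n : ℕ} (hn : 1 ≤ n) :
    circ x ^ n ≠ 1 := by
  rw [← circ_nat_mul]; exact circ_nat_mul_ne_one_of_irrational hx hn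

/-! ### §1. Integrability: `v ∈ L²_loc` (the only analytic input on `u`; Amoroso: "`r(t) = log|R(e^{it})|`
belongs to `L^p(0, 2π)` for `1 ≤ p < ∞`") -/

/-- Jordan's inequality on both halves: `2 min(x, 1 − x) ≤ sin(πx)` for `0 ≤ x ≤ 1`. [folklore] -/
private theorem two_mul_min_le_sin {x : ℝ} (h0 : 0 ≤ x) (h1 : x ≤ 1) :
    2 * min x (1 - x) ≤ Real.sin (π * x) := by
  rcases le_total x (1 / 2) with h | h
  · rw [min_eq_left (by linarith)]
    have := Real.mul_le_sin (x := π * x) (by positivity) (by nlinarith [Real.pi_pos])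
    calc 2 * x = 2 / π * (π * x) := by field_simp
      _ ≤ _ := this
  · rw [min_eq_right (by linarith)]
    have := Real.mul_le_sin (x := π * (1 - x)) (by nlinarith [Real.pi_pos])
      (by nlinarith [Real.pi_pos])
    rw [show π * (1 - x) = π - π * x by ring, Real.sin_pi_sub] at this
    calc 2 * (1 - x) = 2 / π * (π - π * x) := by field_simp
      _ ≤ _ := this

/-- `(log s)² ≤ 16 s^{−1/2}` for `0 < s ≤ 1` (from `log y ≤ y − 1` at `y = s^{−1/4}`). [folklore] -/
private theorem sq_log_le_rpow {s : ℝ} (hs0 : 0 < s) (hs1 : s ≤ 1) :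
    Real.log s ^ 2 ≤ 16 * s ^ (-(1 / 2 : ℝ)) := by
  set t := s ^ (-(1 / 4 : ℝ)) with ht
  have ht0 : 0 < t := Real.rpow_pos_of_pos hs0 _
  have hlogt : Real.log t = -(1 / 4) * Real.log s := by rw [ht, Real.log_rpow hs0]
  have hlogs : Real.log s = -4 * Real.log t := by rw [hlogt]; ring
  have ht1 : 1 ≤ t := Real.one_le_rpow_of_pos_of_le_one_of_nonpos hs0 hs1 (by norm_num)
  have hlt0 : 0 ≤ Real.log t := Real.log_nonneg ht1
  have hlt : Real.log t ≤ t := by linarith [Real.log_le_sub_one_of_pos ht0]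
  have htt : t ^ 2 = s ^ (-(1 / 2 : ℝ)) := by
    rw [ht, ← Real.rpow_natCast, ← Real.rpow_mul hs0.le]; norm_num
  rw [hlogs, ← htt]
  nlinarith [mul_self_le_mul_self hlt0 hlt]

/-- The `L²` majorant: `v(x)² ≤ 1 + 8 (x^{−1/2} + (1 − x)^{−1/2})` on `(0, 1)`. [folklore] -/
private theorem vlog_sq_le {x : ℝ} (h0 : 0 < x) (h1 : x < 1) :
    vlog x ^ 2 ≤ 1 + 8 * (x ^ (-(1 / 2 : ℝ)) + (1 - x) ^ (-(1 / 2 : ℝ))) := by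
  rw [vlog_eq_log_sin]
  have hsin : 0 < Real.sin (π * x) :=
    Real.sin_pos_of_pos_of_lt_pi (by positivity) (by nlinarith [Real.pi_pos])
  rw [abs_of_pos hsin]
  have hmin := two_mul_min_le_sin h0.le h1.le
  set s := 2 * Real.sin (π * x) with hs
  have hs0 : 0 < s := by positivity
  have hs2 : s ≤ 2 := by have := Real.sin_le_one (π * x); linarith
  have hxr : 0 < x ^ (-(1 / 2 : ℝ)) := Real.rpow_pos_of_pos h0 _
  have h1xr : 0 < (1 - x) ^ (-(1 / 2 : ℝ)) := Real.rpow_pos_of_pos (by linarith) _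
  by_cases hs1 : 1 ≤ s
  · have hl0 : 0 ≤ Real.log s := Real.log_nonneg hs1
    have hl2 : Real.log s ≤ Real.log 2 := Real.log_le_log hs0 hs2
    have hlog2 : Real.log 2 < 1 := by linarith [Real.log_two_lt_d9]
    nlinarith
  · push Not at hs1
    have hmain := sq_log_le_rpow hs0 hs1.le
    set m := min x (1 - x) with hm
    have hm0 : 0 < m := lt_min h0 (by linarith)
    have hsm : 4 * m ≤ s := by rw [hs]; linarith
    have h2 : s ^ (-(1 / 2 : ℝ)) ≤ (4 * m) ^ (-(1 / 2 : ℝ)) :=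
      Real.rpow_le_rpow_of_nonpos (by positivity) hsm (by norm_num)
    have h4 : (4 : ℝ) ^ (-(1 / 2 : ℝ)) = 2⁻¹ := by
      rw [Real.rpow_neg (by norm_num), ← Real.sqrt_eq_rpow, show (4 : ℝ) = 2 ^ 2 by norm_num,
        Real.sqrt_sq (by norm_num)]
    have h3 : (4 * m) ^ (-(1 / 2 : ℝ)) = 2⁻¹ * m ^ (-(1 / 2 : ℝ)) := by
      rw [Real.mul_rpow (by norm_num) hm0.le, h4]
    have h5 : m ^ (-(1 / 2 : ℝ)) ≤ x ^ (-(1 / 2 : ℝ)) + (1 - x) ^ (-(1 / 2 : ℝ)) := by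
      rcases min_choice x (1 - x) with h | h <;> rw [hm, h] <;> linarith
    nlinarith

/-- `v² ∈ L¹(0,1)`. [folklore] -/
private theorem intervalIntegrable_vlog_sq_unit : IntervalIntegrable (fun x => vlog x ^ 2) volume 0 1 := by
  have hb : IntervalIntegrable
      (fun x : ℝ => 1 + 8 * (x ^ (-(1 / 2 : ℝ)) + (1 - x) ^ (-(1 / 2 : ℝ)))) volume 0 1 := by
    refine intervalIntegrable_const.add ((IntervalIntegrable.add ?_ ?_).const_mul 8)
    · exact intervalIntegral.intervalIntegrable_rpow' (by norm_num)
    · have h := (intervalIntegral.intervalIntegrable_rpow' (a := 1) (b := 0) (r := -(1 / 2 : ℝ))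
        (by norm_num)).comp_sub_left 1
      simpa using h
  refine hb.mono_fun' ((measurable_vlog.pow_const 2).aestronglyMeasurable) ?_
  rw [Filter.EventuallyLE, ae_restrict_iff' measurableSet_uIoc]
  refine Filter.Eventually.of_forall fun x hx => ?_
  rw [Set.uIoc_of_le zero_le_one] at hx
  rw [Real.norm_eq_abs, abs_of_nonneg (sq_nonneg _)]
  rcases eq_or_lt_of_le hx.2 with h | h
  · rw [h]
    have hv : vlog 1 = 0 := by exact_mod_cast vlog_int 1
    rw [hv, sub_self, Real.zero_rpow (by norm_num)]
    norm_num
  · exact vlog_sq_le hx.1 h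

/-- `v² ∈ L¹_loc` (periodicity). [folklore] -/
private theorem intervalIntegrable_vlog_sq (a b : ℝ) : IntervalIntegrable (fun x => vlog x ^ 2) volume a b :=
  (vlog_periodic.comp fun y => y ^ 2).intervalIntegrable₀ one_ne_zero
    intervalIntegrable_vlog_sq_unit a b

/-- `x ↦ v(cx + d)² ∈ L¹_loc` for `c ≠ 0`. [folklore] -/
private theorem intervalIntegrable_vlog_sq_affine {c : ℝ} (hc : c ≠ 0) (d a b : ℝ) :
    IntervalIntegrable (fun x => vlog (c * x + d) ^ 2) volume a b := by
  have h := ((intervalIntegrable_vlog_sq (c * a + d) (c * b + d)).comp_add_right d).comp_mul_left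
    (c := c)
  have ha : (c * a + d - d) / c = a := by field_simp; ring
  have hb : (c * b + d - d) / c = b := by field_simp; ring
  rw [ha, hb] at h
  exact h

/-- `x ↦ v(cx + d) ∈ L¹_loc` for `c ≠ 0`. [folklore] -/
private theorem intervalIntegrable_vlog_affine {c : ℝ} (hc : c ≠ 0) (d a b : ℝ) :
    IntervalIntegrable (fun x => vlog (c * x + d)) volume a b := by
  refine ((intervalIntegrable_const (c := (1 : ℝ))).add
    (intervalIntegrable_vlog_sq_affine hc d a b)).mono_fun'
    ((measurable_vlog.comp (by fun_prop)).aestronglyMeasurable) ?_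
  refine Filter.Eventually.of_forall fun x => ?_
  dsimp only
  rw [Real.norm_eq_abs]
  nlinarith [sq_abs (vlog (c * x + d)), abs_nonneg (vlog (c * x + d))]

/-- `v ∈ L¹_loc`. [folklore] -/
private theorem intervalIntegrable_vlog (a b : ℝ) : IntervalIntegrable vlog volume a b := by
  have h := intervalIntegrable_vlog_affine one_ne_zero 0 a b
  simpa using h

/-- Products `v(c₁x + d₁) v(c₂x + d₂)` are locally integrable (`2|αβ| ≤ α² + β²`). [folklore] -/
private theorem intervalIntegrable_vlog_mul {c₁ c₂ : ℝ} (h1 : c₁ ≠ 0) (h2 : c₂ ≠ 0) (d₁ d₂ a b : ℝ) :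
    IntervalIntegrable (fun x => vlog (c₁ * x + d₁) * vlog (c₂ * x + d₂)) volume a b := by
  refine ((intervalIntegrable_vlog_sq_affine h1 d₁ a b).add
    (intervalIntegrable_vlog_sq_affine h2 d₂ a b)).mono_fun' ?_ ?_
  · exact ((measurable_vlog.comp (by fun_prop)).mul
      (measurable_vlog.comp (by fun_prop))).aestronglyMeasurable
  · refine Filter.Eventually.of_forall fun x => ?_
    dsimp only
    rw [Real.norm_eq_abs, abs_mul]
    nlinarith [two_mul_le_add_sq (|vlog (c₁ * x + d₁)|) (|vlog (c₂ * x + d₂)|),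
      sq_abs (vlog (c₁ * x + d₁)), sq_abs (vlog (c₂ * x + d₂)), abs_nonneg (vlog (c₁ * x + d₁)),
      abs_nonneg (vlog (c₂ * x + d₂))]


/-! ### §2. The root-of-unity identity `∑_{k<a} v(x + bk/a) = v(ax)` for `(a, b) = 1`
(`∏_{k<a} |w ζ^k − 1| = |w^a − 1|`, `ζ = e(b/a)` a primitive `a`-th root of unity) -/

/-- `∏_{k<a} ‖w ζ^k − 1‖ = ‖w^a − 1‖` for a primitive `a`-th root of unity `ζ`. [folklore] -/
private theorem prod_norm_mul_pow_sub_one {a : ℕ} (ha : 0 < a) {ζ : ℂ} (hζ : IsPrimitiveRoot ζ a) (w : ℂ) :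
    ∏ k ∈ range a, ‖w * ζ ^ k - 1‖ = ‖w ^ a - 1‖ := by
  have hζ0 : ζ ≠ 0 := hζ.ne_zero ha.ne'
  have hnorm : ‖ζ‖ = 1 := Complex.norm_eq_one_of_pow_eq_one hζ.pow_eq_one ha.ne'
  have hstep : ∀ k ∈ range a, ‖w * ζ ^ k - 1‖ = ‖w - (ζ⁻¹) ^ k‖ := by
    intro k _
    have : w * ζ ^ k - 1 = ζ ^ k * (w - (ζ⁻¹) ^ k) := by
      rw [inv_pow, mul_sub, mul_inv_cancel₀ (pow_ne_zero k hζ0)]; ring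
    rw [this, norm_mul, norm_pow, hnorm, one_pow, one_mul]
  rw [prod_congr rfl hstep, ← norm_prod]
  have hpoly := X_pow_sub_C_eq_prod hζ.inv ha (one_pow a : (1 : ℂ) ^ a = 1)
  have heval := congr_arg (Polynomial.eval w) hpoly
  simp only [eval_sub, eval_pow, eval_X, eval_C, eval_prod, mul_one] at heval
  rw [← heval]

/-- For irrational `x`, `a ≥ 1` and `(a, b) = 1`: `∑_{k<a} v(x + bk/a) = v(ax)` (the logarithm of
`∏_{k<a} |e(x) ζ^k − 1| = |e(x)^a − 1|`, `ζ = e(b/a)`; Edwards' (2) and the permutation of the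
residues `bk mod a` in one step). [cite: Amoroso1996, §5 (u is the log of |1 − z| at roots of unity)] -/
private theorem sum_vlog_add_mul_div {a b : ℕ} (ha : 1 ≤ a) (hab : a.Coprime b) {x : ℝ} (hx : Irrational x) :
    ∑ k ∈ range a, vlog (x + (b * k : ℕ) / (a : ℝ)) = vlog (a * x) := by
  have ha0 : (a : ℝ) ≠ 0 := by positivity
  set ζ : ℂ := Complex.exp (2 * π * Complex.I * (b / a : ℂ)) with hζ
  have hprim : IsPrimitiveRoot ζ a := Complex.isPrimitiveRoot_exp_of_coprime b a (by omega) hab.symm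
  have hck : ∀ k : ℕ, circ (x + (b * k : ℕ) / (a : ℝ)) = circ x * ζ ^ k := by
    intro k
    rw [circ_add, hζ, ← Complex.exp_nat_mul]
    unfold circ
    congr 2
    push_cast
    ring
  have hne : ∀ k ∈ range a, ‖circ (x + (b * k : ℕ) / (a : ℝ)) - 1‖ ≠ 0 := by
    intro k _ h
    rw [norm_eq_zero, sub_eq_zero, circ_eq_one_iff] at h
    obtain ⟨m, hm⟩ := h
    apply natMul_ne_intCast_of_irrational hx ha (a * m - b * k)
    have : (a : ℝ) * (x + (b * k : ℕ) / (a : ℝ)) = a * m := by rw [hm]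
    rw [mul_add, mul_div_cancel₀ _ ha0] at this
    push_cast at this ⊢
    linarith
  calc ∑ k ∈ range a, vlog (x + (b * k : ℕ) / (a : ℝ))
      = Real.log (∏ k ∈ range a, ‖circ (x + (b * k : ℕ) / (a : ℝ)) - 1‖) := by
        rw [Real.log_prod hne]; rfl
    _ = Real.log (∏ k ∈ range a, ‖circ x * ζ ^ k - 1‖) := by simp_rw [hck]
    _ = Real.log ‖circ x ^ a - 1‖ := by rw [prod_norm_mul_pow_sub_one (by omega) hprim]
    _ = vlog (a * x) := by rw [vlog, circ_nat_mul]

/-! ### §3. The integrals `J_{ab} = ∫₀¹ v(ax) v(bx) dx = (a,b)² J₁₁/(ab)` (Edwards' computation of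
Franel's `I_{ab}`, verbatim with `B̄₁ ↦ v`; the value `J₁₁ = π²/12` is not needed) -/

/-- `J_{ab} = ∫₀¹ v(ax) v(bx) dx` (the Gram matrix of the dilates of `v`; proof plumbing). [folklore] -/
def J (a b : ℕ) : ℝ := ∫ x in (0 : ℝ)..1, vlog (a * x) * vlog (b * x)

/-- `J_{ab} = J_{ba}`. [folklore] -/
private theorem J_comm (a b : ℕ) : J a b = J b a := by
  unfold J; congr 1; ext x; ring

/-- `J₁₁ ≥ 0`. [folklore] -/
private theorem J_one_one_nonneg : 0 ≤ J 1 1 :=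
  intervalIntegral.integral_nonneg zero_le_one fun _ _ => mul_self_nonneg _

/-- The coprime case: `J_{ab} = a⁻¹ J_{1b}` for `(a, b) = 1` (substitute `v = ax`, periodicity,
and §2). [folklore] -/
private theorem J_eq_of_coprime {a b : ℕ} (ha : 1 ≤ a) (hb : 1 ≤ b) (hab : a.Coprime b) :
    J a b = (a : ℝ)⁻¹ * J 1 b := by
  have ha0 : (a : ℝ) ≠ 0 := by positivity
  have hb0 : (b : ℝ) ≠ 0 := by positivity
  set F : ℝ → ℝ := fun v => vlog v * vlog ((b : ℝ) * v / a) with hF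
  have hFint : ∀ s t : ℝ, IntervalIntegrable F volume s t := fun s t => by
    have h := intervalIntegrable_vlog_mul one_ne_zero (div_ne_zero hb0 ha0) 0 0 s t
    refine h.congr fun v _ => ?_
    simp only [hF, one_mul, add_zero]
    ring_nf
  have h1 : J a b = ∫ u in (0 : ℝ)..1, F ((a : ℝ) * u) := by
    unfold J; congr 1; ext u; rw [hF]; congr 2; field_simp
  have h2 : ∫ u in (0 : ℝ)..1, F ((a : ℝ) * u) = (a : ℝ)⁻¹ * ∫ v in (0 : ℝ)..a, F v := by
    rw [integral_comp_mul_left F ha0, mul_zero, mul_one, smul_eq_mul]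
  have h3 : ∫ v in (0 : ℝ)..a, F v = ∑ k ∈ range a, ∫ t in (0 : ℝ)..1, F (t + k) := by
    have hadj := sum_integral_adjacent_intervals (a := fun k : ℕ => (k : ℝ)) (n := a)
      (fun k _ => hFint _ _)
    simp only [Nat.cast_zero] at hadj
    rw [← hadj]
    refine sum_congr rfl fun k _ => ?_
    rw [integral_comp_add_right F (k : ℝ), zero_add, Nat.cast_add, Nat.cast_one, add_comm (k : ℝ) 1]
  have h4 : ∀ k : ℕ, ∀ t : ℝ,
      F (t + k) = vlog t * vlog ((b : ℝ) * t / a + (b * k : ℕ) / (a : ℝ)) := by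
    intro k t
    simp only [hF]
    rw [vlog_add_nat]
    congr 2
    push_cast; field_simp
  have h5 : ∑ k ∈ range a, ∫ t in (0 : ℝ)..1, F (t + k) =
      ∫ t in (0 : ℝ)..1, vlog t *
        ∑ k ∈ range a, vlog ((b : ℝ) * t / a + (b * k : ℕ) / (a : ℝ)) := by
    rw [← intervalIntegral.integral_finsetSum (fun k _ => ?_)]
    · refine integral_congr fun t _ => ?_
      simp only [h4, mul_sum]
    · simp only [h4]
      have h := intervalIntegrable_vlog_mul one_ne_zero (div_ne_zero hb0 ha0) 0
        ((b * k : ℕ) / (a : ℝ)) 0 1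
      refine h.congr fun v _ => ?_
      simp only [one_mul, add_zero]
      ring_nf
  have h6 : ∀ᵐ t : ℝ, ∑ k ∈ range a, vlog ((b : ℝ) * t / a + (b * k : ℕ) / (a : ℝ)) =
      vlog ((b : ℝ) * t) := by
    filter_upwards [ae_irrational] with t ht
    rw [sum_vlog_add_mul_div ha hab ((ht.natCast_mul (by omega : b ≠ 0)).div_natCast
      (by omega : a ≠ 0))]
    congr 1; field_simp
  rw [h1, h2, h3, h5]
  congr 1
  unfold J
  refine integral_congr_ae ?_
  filter_upwards [h6] with t ht _
  rw [ht, Nat.cast_one, one_mul]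

/-- `J_{ab} = J₁₁/(ab)` for coprime `a, b ≥ 1`. [folklore] -/
private theorem J_of_coprime {a b : ℕ} (ha : 1 ≤ a) (hb : 1 ≤ b) (hab : a.Coprime b) :
    J a b = J 1 1 / ((a : ℝ) * b) := by
  have ha0 : (a : ℝ) ≠ 0 := by positivity
  have hb0 : (b : ℝ) ≠ 0 := by positivity
  rw [J_eq_of_coprime ha hb hab, J_comm 1 b, J_eq_of_coprime hb le_rfl (Nat.coprime_one_right b)]
  field_simp

/-- `∫₀¹ G(cu) du = ∫₀¹ G` for a `1`-periodic locally integrable `G` and an integer `c ≥ 1`.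
[folklore] -/
private theorem integral_comp_natMul_of_periodic {G : ℝ → ℝ} (hG : ∀ t : ℝ, ∀ k : ℕ, G (t + k) = G t)
    (hint : ∀ s t : ℝ, IntervalIntegrable G volume s t) {c : ℕ} (hc : 1 ≤ c) :
    ∫ u in (0 : ℝ)..1, G ((c : ℝ) * u) = ∫ t in (0 : ℝ)..1, G t := by
  have hc0 : (c : ℝ) ≠ 0 := by positivity
  rw [integral_comp_mul_left G hc0, mul_zero, mul_one, smul_eq_mul]
  have hadj := sum_integral_adjacent_intervals (a := fun k : ℕ => (k : ℝ)) (n := c)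
    (fun k _ => hint _ _)
  simp only [Nat.cast_zero] at hadj
  rw [← hadj]
  have h : ∀ k ∈ range c, ∫ x in ((k : ℕ) : ℝ)..((k + 1 : ℕ) : ℝ), G x = ∫ t in (0 : ℝ)..1, G t := by
    intro k _
    have e : ∫ x in (0 : ℝ)..1, G (x + k) = ∫ x in ((k : ℕ) : ℝ)..((k + 1 : ℕ) : ℝ), G x := by
      rw [integral_comp_add_right, zero_add]
      congr 1
      push_cast; ring
    rw [← e]
    exact integral_congr fun t _ => hG t k
  rw [sum_congr rfl h, sum_const, card_range, nsmul_eq_mul, ← mul_assoc, inv_mul_cancel₀ hc0,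
    one_mul]

/-- `J_{(cα)(cβ)} = J_{αβ}` (`α, β, c ≥ 1`). [folklore] -/
private theorem J_mul_mul {c α β : ℕ} (hc : 1 ≤ c) (hα : 1 ≤ α) (hβ : 1 ≤ β) :
    J (c * α) (c * β) = J α β := by
  have hα0 : (α : ℝ) ≠ 0 := by positivity
  have hβ0 : (β : ℝ) ≠ 0 := by positivity
  unfold J
  have hint : ∀ s t : ℝ,
      IntervalIntegrable (fun t => vlog ((α : ℝ) * t) * vlog ((β : ℝ) * t)) volume s t := by
    intro s t
    have h := intervalIntegrable_vlog_mul hα0 hβ0 0 0 s t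
    simpa using h
  have h := integral_comp_natMul_of_periodic
    (G := fun t => vlog ((α : ℝ) * t) * vlog ((β : ℝ) * t)) (fun t k => by
      show vlog ((α : ℝ) * (t + k)) * vlog ((β : ℝ) * (t + k)) = vlog ((α : ℝ) * t) * vlog ((β : ℝ) * t)
      rw [mul_add, mul_add, show (α : ℝ) * k = ((α * k : ℕ) : ℝ) by push_cast; ring,
        show (β : ℝ) * k = ((β * k : ℕ) : ℝ) by push_cast; ring, vlog_add_nat, vlog_add_nat])
    hint hc
  rw [← h]
  congr 1; ext u
  push_cast
  ring_nf

/-- **`J_{ab} = (a,b)² J₁₁/(ab)`** for `a, b ≥ 1`. [folklore] -/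
private theorem J_eq {a b : ℕ} (ha : 1 ≤ a) (hb : 1 ≤ b) :
    J a b = ((a.gcd b : ℕ) : ℝ) ^ 2 * J 1 1 / ((a : ℝ) * b) := by
  set c := a.gcd b with hc
  have hc0 : 0 < c := Nat.gcd_pos_of_pos_left b (by omega)
  obtain ⟨α, hα⟩ := Nat.gcd_dvd_left a b
  obtain ⟨β, hβ⟩ := Nat.gcd_dvd_right a b
  rw [← hc] at hα hβ
  have hα1 : 1 ≤ α := by
    rcases Nat.eq_zero_or_pos α with h | h
    · rw [h, mul_zero] at hα; omega
    · exact h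
  have hβ1 : 1 ≤ β := by
    rcases Nat.eq_zero_or_pos β with h | h
    · rw [h, mul_zero] at hβ; omega
    · exact h
  have hcop : α.Coprime β := by
    have h := Nat.coprime_div_gcd_div_gcd (m := a) (n := b) hc0
    rw [← hc] at h
    have e1 : a / c = α := by rw [hα, Nat.mul_div_cancel_left _ hc0]
    have e2 : b / c = β := by rw [hβ, Nat.mul_div_cancel_left _ hc0]
    rwa [e1, e2] at h
  rw [hα, hβ, J_mul_mul hc0 hα1 hβ1, J_of_coprime hα1 hβ1 hcop]
  have hcR : (c : ℝ) ≠ 0 := by exact_mod_cast hc0.ne'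
  have hαR : (α : ℝ) ≠ 0 := by positivity
  have hβR : (β : ℝ) ≠ 0 := by positivity
  push_cast
  field_simp

/-! ### §4. The Möbius-side square integral: `∫₀¹ (∑_{k≤n} M(n/k) v(kx))² dx = ∑∑ M(n/a)M(n/b) (a,b)² J₁₁/(ab)`
and its bound under `|M(y)| ≤ C y^s` -/

/-- `g_n(x) = ∑_{k ≤ n} M(n/k) v(kx)` — for irrational `x` this is `log |A_n(e(x))|` (§5).
[cite: Amoroso1996, §5 (`log|Φ(e^{it})| = ∑ M(N/m) u(mt)`)] -/
def gsum (n : ℕ) (x : ℝ) : ℝ := ∑ k ∈ Icc 1 n, (mertensFunction ((n : ℝ) / k) : ℝ) * vlog (k * x)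

/-- `g_n` is locally integrable. [folklore] -/
private theorem intervalIntegrable_gsum (n : ℕ) (a b : ℝ) : IntervalIntegrable (gsum n) volume a b := by
  have h : gsum n = ∑ k ∈ Icc 1 n, fun x => (mertensFunction ((n : ℝ) / k) : ℝ) * vlog (k * x) := by
    ext x; simp [gsum, Finset.sum_apply]
  rw [h]
  refine IntervalIntegrable.sum _ fun k hk => ?_
  have hk0 : (k : ℝ) ≠ 0 := by have := (mem_Icc.1 hk).1; positivity
  have := intervalIntegrable_vlog_affine hk0 0 a b
  simp only [add_zero] at this
  exact this.const_mul _

/-- `g_n²` is locally integrable. [folklore] -/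
private theorem intervalIntegrable_gsum_sq (n : ℕ) (a b : ℝ) :
    IntervalIntegrable (fun x => gsum n x ^ 2) volume a b := by
  have h : (fun x => gsum n x ^ 2) =
      ∑ p ∈ Icc 1 n ×ˢ Icc 1 n, fun x =>
        ((mertensFunction ((n : ℝ) / p.1) : ℝ) * (mertensFunction ((n : ℝ) / p.2) : ℝ)) *
          (vlog (p.1 * x) * vlog (p.2 * x)) := by
    ext x
    rw [Finset.sum_apply, gsum, sq, sum_mul_sum, sum_product]
    refine sum_congr rfl fun a _ => sum_congr rfl fun b _ => by ring
  rw [h]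
  refine IntervalIntegrable.sum _ fun p hp => ?_
  have hp1 : ((p.1 : ℕ) : ℝ) ≠ 0 := by have := (mem_Icc.1 (mem_product.1 hp).1).1; positivity
  have hp2 : ((p.2 : ℕ) : ℝ) ≠ 0 := by have := (mem_Icc.1 (mem_product.1 hp).2).1; positivity
  have := intervalIntegrable_vlog_mul hp1 hp2 0 0 a b
  simp only [add_zero] at this
  exact this.const_mul _

/-- **The Möbius-side evaluation**:
`∫₀¹ g_n² = ∑_{a ≤ n} ∑_{b ≤ n} M(n/a) M(n/b) (a,b)² J₁₁/(ab)`. [folklore] -/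
private theorem integral_gsum_sq (n : ℕ) :
    ∫ x in (0 : ℝ)..1, gsum n x ^ 2 =
      ∑ a ∈ Icc 1 n, ∑ b ∈ Icc 1 n, (mertensFunction ((n : ℝ) / a) : ℝ) *
        (mertensFunction ((n : ℝ) / b) : ℝ) * (((a.gcd b : ℕ) : ℝ) ^ 2 * J 1 1 / ((a : ℝ) * b)) := by
  have hexp : ∀ x : ℝ, gsum n x ^ 2 =
      ∑ p ∈ Icc 1 n ×ˢ Icc 1 n, ((mertensFunction ((n : ℝ) / p.1) : ℝ) *
        (mertensFunction ((n : ℝ) / p.2) : ℝ)) * (vlog (p.1 * x) * vlog (p.2 * x)) := by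
    intro x
    rw [gsum, sq, sum_mul_sum, sum_product]
    refine sum_congr rfl fun a _ => sum_congr rfl fun b _ => by ring
  simp_rw [hexp]
  rw [intervalIntegral.integral_finsetSum (fun p hp => ?_), sum_product]
  · refine sum_congr rfl fun a ha => sum_congr rfl fun b hb => ?_
    rw [intervalIntegral.integral_const_mul]
    simp only
    rw [show (∫ x in (0 : ℝ)..1, vlog ((a : ℝ) * x) * vlog ((b : ℝ) * x)) = J a b from rfl,
      J_eq (mem_Icc.1 ha).1 (mem_Icc.1 hb).1]
  · have hp1 : ((p.1 : ℕ) : ℝ) ≠ 0 := by have := (mem_Icc.1 (mem_product.1 hp).1).1; positivity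
    have hp2 : ((p.2 : ℕ) : ℝ) ≠ 0 := by have := (mem_Icc.1 (mem_product.1 hp).2).1; positivity
    have := intervalIntegrable_vlog_mul hp1 hp2 0 0 0 1
    simp only [add_zero] at this
    exact this.const_mul _

open FareyFranel in
/-- **The bound on the Möbius side**: if `|M(y)| ≤ C y^s` for `y ≥ 1` (`s ≥ 1/2`), then
`∫₀¹ g_n² ≤ J₁₁ C² n^{2s} (1 + log n)³` (Edwards' double sum `∑∑ (a,b)² (ab)^{−3/2} ≤ (1 + log n)³`,
tree `FareyFranel.sum_sum_gcd_sq_w32_le`). [folklore] -/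
private theorem integral_gsum_sq_le {C s : ℝ} (hC0 : 0 ≤ C) (hs : 1 / 2 ≤ s)
    (hC : ∀ y : ℝ, 1 ≤ y → |(mertensFunction y : ℝ)| ≤ C * y ^ s) {n : ℕ} (hn : 1 ≤ n) :
    ∫ x in (0 : ℝ)..1, gsum n x ^ 2 ≤
      J 1 1 * C ^ 2 * (n : ℝ) ^ (2 * s) * (1 + Real.log n) ^ 3 := by
  have hn' : (1 : ℝ) ≤ n := by exact_mod_cast hn
  have hn0 : (0 : ℝ) < n := by linarith
  have hJ := J_one_one_nonneg
  rw [integral_gsum_sq]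
  have hterm : ∀ a ∈ Icc 1 n, ∀ b ∈ Icc 1 n,
      (mertensFunction ((n : ℝ) / a) : ℝ) * (mertensFunction ((n : ℝ) / b) : ℝ) *
        (((a.gcd b : ℕ) : ℝ) ^ 2 * J 1 1 / ((a : ℝ) * b)) ≤
      J 1 1 * C ^ 2 * (n : ℝ) ^ (2 * s) * (((a.gcd b : ℕ) : ℝ) ^ 2 * (w32 a * w32 b)) := by
    intro a ha b hb
    have ha1 : (1 : ℝ) ≤ a := by exact_mod_cast (mem_Icc.1 ha).1
    have hb1 : (1 : ℝ) ≤ b := by exact_mod_cast (mem_Icc.1 hb).1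
    have ha0 : (0 : ℝ) < a := by linarith
    have hb0 : (0 : ℝ) < b := by linarith
    have han : (1 : ℝ) ≤ (n : ℝ) / a := by
      rw [le_div_iff₀ ha0, one_mul]; exact_mod_cast (mem_Icc.1 ha).2
    have hbn : (1 : ℝ) ≤ (n : ℝ) / b := by
      rw [le_div_iff₀ hb0, one_mul]; exact_mod_cast (mem_Icc.1 hb).2
    have hMa := hC _ han
    have hMb := hC _ hbn
    have hpa : ((n : ℝ) / a) ^ s = (n : ℝ) ^ s / (a : ℝ) ^ s := Real.div_rpow hn0.le ha0.le s
    have hpb : ((n : ℝ) / b) ^ s = (n : ℝ) ^ s / (b : ℝ) ^ s := Real.div_rpow hn0.le hb0.le s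
    have hwa : 1 / ((a : ℝ) ^ s * a) ≤ w32 a := by
      unfold w32
      have h1 : Real.sqrt (a : ℝ) ≤ (a : ℝ) ^ s := by
        rw [Real.sqrt_eq_rpow]
        exact Real.rpow_le_rpow_of_exponent_le ha1 (by linarith)
      rw [mul_comm ((a : ℝ) ^ s)]
      exact one_div_le_one_div_of_le (by positivity) (mul_le_mul_of_nonneg_left h1 ha0.le)
    have hwb : 1 / ((b : ℝ) ^ s * b) ≤ w32 b := by
      unfold w32
      have h1 : Real.sqrt (b : ℝ) ≤ (b : ℝ) ^ s := by
        rw [Real.sqrt_eq_rpow]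
        exact Real.rpow_le_rpow_of_exponent_le hb1 (by linarith)
      rw [mul_comm ((b : ℝ) ^ s)]
      exact one_div_le_one_div_of_le (by positivity) (mul_le_mul_of_nonneg_left h1 hb0.le)
    have hns : (n : ℝ) ^ (2 * s) = (n : ℝ) ^ s * (n : ℝ) ^ s := by
      rw [two_mul, Real.rpow_add hn0]
    have hwa0 : 0 ≤ 1 / ((a : ℝ) ^ s * a) := by positivity
    have hwb0 : 0 ≤ 1 / ((b : ℝ) ^ s * b) := by positivity
    calc (mertensFunction ((n : ℝ) / a) : ℝ) * (mertensFunction ((n : ℝ) / b) : ℝ) *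
          (((a.gcd b : ℕ) : ℝ) ^ 2 * J 1 1 / ((a : ℝ) * b))
        ≤ |(mertensFunction ((n : ℝ) / a) : ℝ)| * |(mertensFunction ((n : ℝ) / b) : ℝ)| *
          (((a.gcd b : ℕ) : ℝ) ^ 2 * J 1 1 / ((a : ℝ) * b)) := by
          rw [← abs_mul]
          exact mul_le_mul_of_nonneg_right (le_abs_self _) (by positivity)
      _ ≤ (C * ((n : ℝ) / a) ^ s) * (C * ((n : ℝ) / b) ^ s) *
          (((a.gcd b : ℕ) : ℝ) ^ 2 * J 1 1 / ((a : ℝ) * b)) := by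
          gcongr
      _ = J 1 1 * C ^ 2 * ((n : ℝ) ^ s * (n : ℝ) ^ s) *
            (((a.gcd b : ℕ) : ℝ) ^ 2 * ((1 / ((a : ℝ) ^ s * a)) * (1 / ((b : ℝ) ^ s * b)))) := by
          rw [hpa, hpb]; field_simp
      _ ≤ J 1 1 * C ^ 2 * ((n : ℝ) ^ s * (n : ℝ) ^ s) *
            (((a.gcd b : ℕ) : ℝ) ^ 2 * (w32 a * w32 b)) :=
          mul_le_mul_of_nonneg_left (mul_le_mul_of_nonneg_left
            (mul_le_mul hwa hwb hwb0 (by unfold w32; positivity)) (by positivity)) (by positivity)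
      _ = J 1 1 * C ^ 2 * (n : ℝ) ^ (2 * s) * (((a.gcd b : ℕ) : ℝ) ^ 2 * (w32 a * w32 b)) := by
          rw [hns]
  calc ∑ a ∈ Icc 1 n, ∑ b ∈ Icc 1 n, (mertensFunction ((n : ℝ) / a) : ℝ) *
        (mertensFunction ((n : ℝ) / b) : ℝ) * (((a.gcd b : ℕ) : ℝ) ^ 2 * J 1 1 / ((a : ℝ) * b))
      ≤ ∑ a ∈ Icc 1 n, ∑ b ∈ Icc 1 n,
          J 1 1 * C ^ 2 * (n : ℝ) ^ (2 * s) * (((a.gcd b : ℕ) : ℝ) ^ 2 * (w32 a * w32 b)) :=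
        sum_le_sum fun a ha => sum_le_sum fun b hb => hterm a ha b hb
    _ = J 1 1 * C ^ 2 * (n : ℝ) ^ (2 * s) *
          ∑ a ∈ Icc 1 n, ∑ b ∈ Icc 1 n, ((a.gcd b : ℕ) : ℝ) ^ 2 * (w32 a * w32 b) := by
        rw [mul_sum]
        exact sum_congr rfl fun a _ => by rw [mul_sum]
    _ ≤ J 1 1 * C ^ 2 * (n : ℝ) ^ (2 * s) * (1 + Real.log n) ^ 3 :=
        mul_le_mul_of_nonneg_left (sum_sum_gcd_sq_w32_le n) (by positivity)

/-! ### §5. `log |A_N(e(x))| = ∑_{k ≤ N} M(N/k) v(kx)` for irrational `x`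
(`A_N = ∏_{d ≤ N} (z^d − 1)^{M(N/d)}`: cyclotomic Möbius inversion and Dirichlet's rearrangement) -/

/-- `Φ_n(e(x)) ≠ 0` for irrational `x` and `n ≥ 1`. [folklore] -/
private theorem eval_cyclotomic_ne_zero {x : ℝ} (hx : Irrational x) {n : ℕ} (hn : 1 ≤ n) :
    eval (circ x) (cyclotomic n ℂ) ≠ 0 := by
  intro h
  haveI : NeZero n := ⟨by omega⟩
  have hroot : IsRoot (cyclotomic n ℂ) (circ x) := h
  rw [isRoot_cyclotomic_iff] at hroot
  exact circ_pow_ne_one_of_irrational hx hn hroot.pow_eq_one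

/-- `∑_{d ∣ n} log |Φ_d(e(x))| = log |e(x)^n − 1|` (`X^n − 1 = ∏_{d ∣ n} Φ_d`). [folklore] -/
private theorem sum_divisors_log_norm_eval_cyclotomic {x : ℝ} (hx : Irrational x) {n : ℕ} (hn : 0 < n) :
    ∑ d ∈ n.divisors, Real.log ‖eval (circ x) (cyclotomic d ℂ)‖ = Real.log ‖circ x ^ n - 1‖ := by
  have h := congr_arg (fun p => ‖eval (circ x) p‖) (prod_cyclotomic_eq_X_pow_sub_one hn ℂ)
  simp only [eval_prod, norm_prod, eval_sub, eval_pow, eval_X, eval_one] at h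
  rw [← h, Real.log_prod]
  intro d hd
  exact norm_ne_zero_iff.2 (eval_cyclotomic_ne_zero hx (Nat.pos_of_mem_divisors hd))

/-- Möbius inversion: `log |Φ_n(e(x))| = ∑_{ab = n} μ(a) v(bx)`. [folklore] -/
private theorem log_norm_eval_cyclotomic_eq {x : ℝ} (hx : Irrational x) {n : ℕ} (hn : 0 < n) :
    Real.log ‖eval (circ x) (cyclotomic n ℂ)‖ =
      ∑ p ∈ n.divisorsAntidiagonal, (ArithmeticFunction.moebius p.1 : ℝ) * vlog (p.2 * x) := by
  have hinv := (ArithmeticFunction.sum_eq_iff_sum_mul_moebius_eq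
    (f := fun d => Real.log ‖eval (circ x) (cyclotomic d ℂ)‖)
    (g := fun m => Real.log ‖circ x ^ m - 1‖)).1
    (fun m hm => sum_divisors_log_norm_eval_cyclotomic hx hm) n hn
  rw [← hinv]
  refine sum_congr rfl fun p _ => ?_
  rw [vlog, circ_nat_mul]

/-- The arithmetic function `k ↦ v(kx)` (`v(0) = 0`). [folklore] -/
def vlogArith (x : ℝ) : ArithmeticFunction ℝ :=
  ⟨fun k => vlog (k * x), by simp [vlog_zero]⟩

/-- Unfolding `vlogArith`. [folklore] -/
private theorem vlogArith_apply (x : ℝ) (k : ℕ) : vlogArith x k = vlog (k * x) := rfl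

/-- **`log |A_N(e(x))| = g_N(x) = ∑_{k ≤ N} M(N/k) v(kx)`** for irrational `x` (Amoroso §5:
`log|Φ(e^{it})| = ∑_{m ≤ N} M(N/m) u(mt)`, from `Φ = ∏_{m ≤ N} (z^m − 1)^{M(N/m)}`).
[cite: Amoroso1996, §5 (5.1)] -/
theorem log_norm_eval_cyclotomicProduct {x : ℝ} (hx : Irrational x) (N : ℕ) :
    Real.log ‖eval (circ x) (cyclotomicProduct N)‖ = gsum N x := by
  have hne : ∀ n ∈ Icc 1 N, ‖eval (circ x) (cyclotomic n ℂ)‖ ≠ 0 := fun n hn =>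
    norm_ne_zero_iff.2 (eval_cyclotomic_ne_zero hx (mem_Icc.1 hn).1)
  rw [cyclotomicProduct, eval_prod, norm_prod, Real.log_prod hne]
  have hIcc : Icc 1 N = Ioc 0 N := by ext d; simp only [mem_Ioc, mem_Icc]; omega
  have h1 : ∀ n ∈ Ioc 0 N, Real.log ‖eval (circ x) (cyclotomic n ℂ)‖ =
      (vlogArith x * (ArithmeticFunction.moebius : ArithmeticFunction ℝ)) n := by
    intro n hn
    rw [log_norm_eval_cyclotomic_eq hx (mem_Ioc.1 hn).1, mul_comm, ArithmeticFunction.mul_apply]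
    refine sum_congr rfl fun p _ => ?_
    rw [ArithmeticFunction.intCoe_apply, vlogArith_apply]
  rw [hIcc, sum_congr rfl h1, ArithmeticFunction.sum_Ioc_mul_eq_sum_sum]
  unfold gsum
  rw [hIcc]
  refine sum_congr rfl fun k _ => ?_
  rw [vlogArith_apply, mul_comm]
  congr 1
  rw [mertensFunction, Nat.floor_div_eq_div]
  push_cast
  refine sum_congr rfl fun m _ => ?_
  rw [ArithmeticFunction.intCoe_apply]

/-! ### §6. From the circle to `[0,1]`: `∫₀¹ log|A_N(e(x))| dx = 0` (Mahler measure of a product of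
cyclotomic polynomials) and `h̃(A_N) = ½ ∫₀¹ |g_N|` -/

/-- Circle averages over the unit circle as integrals over `[0,1]` (`θ = 2πx`). [folklore] -/
private theorem circleAverage_eq_integral_circ (f : ℂ → ℝ) :
    Real.circleAverage f 0 1 = ∫ x in (0 : ℝ)..1, f (circ x) := by
  rw [Real.circleAverage_def]
  have h := intervalIntegral.integral_comp_mul_left (a := 0) (b := 1)
    (fun θ => f (circleMap 0 1 θ)) (by positivity : (2 * π : ℝ) ≠ 0)
  rw [mul_zero, mul_one] at h
  rw [← h]
  refine integral_congr fun x _ => ?_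
  simp only [circleMap, circ, zero_add, Complex.ofReal_one, one_mul]
  congr 1
  push_cast
  ring

/-- **`m(A_N) = 0`**: the logarithmic Mahler measure of `Φ₁⋯Φ_N` vanishes (monic, all roots on the
unit circle). [folklore] -/
private theorem logMahlerMeasure_cyclotomicProduct (N : ℕ) : (cyclotomicProduct N).logMahlerMeasure = 0 := by
  have hmonic : (cyclotomicProduct N).Monic :=
    monic_prod_of_monic _ _ fun n _ => cyclotomic.monic n ℂ
  rw [logMahlerMeasure_eq_log_leadingCoeff_add_sum_log_roots, hmonic.leadingCoeff, norm_one,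
    Real.log_one, zero_add]
  refine Multiset.sum_eq_zero fun y hy => ?_
  rw [Multiset.mem_map] at hy
  obtain ⟨z, hz, rfl⟩ := hy
  have hne : (∏ n ∈ Icc 1 N, cyclotomic n ℂ) ≠ 0 := hmonic.ne_zero
  rw [cyclotomicProduct, roots_prod _ _ hne, Multiset.mem_bind] at hz
  obtain ⟨n, hn, hzn⟩ := hz
  have hn' : n ∈ Icc 1 N := by simpa using hn
  have hn1 : 1 ≤ n := (mem_Icc.1 hn').1
  haveI : NeZero n := ⟨by omega⟩
  rw [mem_roots (cyclotomic_ne_zero n ℂ), isRoot_cyclotomic_iff] at hzn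
  have hnorm : ‖z‖ = 1 := Complex.norm_eq_one_of_pow_eq_one hzn.pow_eq_one (by omega)
  rw [hnorm, Real.posLog_eq_zero_iff, abs_one]

/-- `∫₀¹ log |A_N(e(x))| dx = 0`. [folklore] -/
private theorem integral_log_norm_eval_cyclotomicProduct (N : ℕ) :
    ∫ x in (0 : ℝ)..1, Real.log ‖eval (circ x) (cyclotomicProduct N)‖ = 0 := by
  rw [show (∫ x in (0 : ℝ)..1, Real.log ‖eval (circ x) (cyclotomicProduct N)‖) =
      Real.circleAverage (fun z => Real.log ‖eval z (cyclotomicProduct N)‖) 0 1 from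
      (circleAverage_eq_integral_circ (fun z => Real.log ‖eval z (cyclotomicProduct N)‖)).symm,
    ← logMahlerMeasure_def,
    logMahlerMeasure_cyclotomicProduct]

/-- `log |A_N(e(x))| = g_N(x)` for a.e. `x`. [folklore] -/
private theorem ae_log_norm_eval_eq_gsum (N : ℕ) :
    ∀ᵐ x : ℝ, Real.log ‖eval (circ x) (cyclotomicProduct N)‖ = gsum N x :=
  ae_irrational.mono fun _ hx => log_norm_eval_cyclotomicProduct hx N

/-- `x ↦ log |A_N(e(x))|` is locally integrable. [folklore] -/
private theorem intervalIntegrable_log_norm_eval (N : ℕ) (a b : ℝ) :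
    IntervalIntegrable (fun x => Real.log ‖eval (circ x) (cyclotomicProduct N)‖) volume a b :=
  (intervalIntegrable_gsum N a b).congr_ae
    (ae_restrict_of_ae ((ae_log_norm_eval_eq_gsum N).mono fun _ hx => hx.symm))

/-- **`h̃(A_N) = ½ ∫₀¹ |g_N(x)| dx`** (`log⁺ = ½(log + |log|)` and `∫ log|A_N| = 0`; Amoroso §3:
"`∫₀^{2π} |log|R(e^{it})|| dt = 4 h̃(R)`" for `R` with zeros on the unit circle).
[cite: Amoroso1996, §3 (the identity ∫|log|R|| = 4h̃(R))] -/
theorem posLogMahlerMeasure_cyclotomicProduct_eq (N : ℕ) :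
    posLogMahlerMeasure (cyclotomicProduct N) = 2⁻¹ * ∫ x in (0 : ℝ)..1, |gsum N x| := by
  rw [posLogMahlerMeasure, circleAverage_eq_integral_circ]
  have hI := intervalIntegrable_log_norm_eval N 0 1
  simp_rw [← Real.half_mul_log_add_log_abs]
  rw [intervalIntegral.integral_const_mul, intervalIntegral.integral_add hI hI.abs,
    integral_log_norm_eval_cyclotomicProduct, zero_add]
  congr 1
  refine integral_congr_ae ?_
  filter_upwards [ae_log_norm_eval_eq_gsum N] with x hx _
  rw [hx]

/-! ### §7. The first Fourier coefficient: `∫₀¹ g_N(x) cos(2πx) dx = −M(N)/2`, hence the RH-free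
lower bound `|M(N)| ≤ 4 h̃(A_N)` (Amoroso (5.2), from Prop. 3.1: `∫₀^{2π} u(nt) cos νt dt` vanishes
unless `n ∣ ν`, and `A_N = ∏_{n≤N} (z^n − 1)^{M(N/n)}` has first exponent `ε₁ = M(N)`) -/

/-- `∑_{j<k} cos(2π(y + j)/k) = 0` for `k ≥ 2` (real part of a vanishing sum of `k`-th roots of
unity). [folklore] -/
private theorem sum_cos_eq_zero {k : ℕ} (hk : 2 ≤ k) (y : ℝ) :
    ∑ j ∈ range k, Real.cos (2 * π * (y + j) / k) = 0 := by
  set ζ : ℂ := Complex.exp (2 * π * Complex.I / k) with hζ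
  have hprim : IsPrimitiveRoot ζ k := Complex.isPrimitiveRoot_exp k (by omega)
  have hgeom := hprim.geom_sum_eq_zero hk
  have hcos : ∀ j : ℕ, Real.cos (2 * π * (y + j) / k) =
      (Complex.exp (2 * π * Complex.I * y / k) * ζ ^ j).re := by
    intro j
    rw [hζ, ← Complex.exp_nat_mul, ← Complex.exp_add, ← Complex.exp_ofReal_mul_I_re]
    congr 2
    push_cast
    ring
  simp_rw [hcos]
  rw [← Complex.re_sum, ← mul_sum, hgeom, mul_zero, Complex.zero_re]

/-- `∫₀¹ v(kx) cos(2πx) dx = 0` for `k ≥ 2`. [cite: Amoroso1996, Prop. 3.1 (∫ u(nt) cos νt dt = 0 unless n ∣ ν)] -/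
theorem integral_vlog_natMul_mul_cos {k : ℕ} (hk : 2 ≤ k) :
    ∫ x in (0 : ℝ)..1, vlog (k * x) * Real.cos (2 * π * x) = 0 := by
  have hk0 : (k : ℝ) ≠ 0 := by positivity
  set F : ℝ → ℝ := fun y => vlog y * Real.cos (2 * π * y / k) with hF
  have hFint : ∀ s t : ℝ, IntervalIntegrable F volume s t := fun s t =>
    (intervalIntegrable_vlog s t).mul_continuousOn (Continuous.continuousOn (by fun_prop))
  have h1 : (fun x => vlog (k * x) * Real.cos (2 * π * x)) = fun x => F ((k : ℝ) * x) := by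
    ext x; simp only [hF]; congr 2; field_simp
  rw [h1, integral_comp_mul_left F hk0, mul_zero, mul_one, smul_eq_mul]
  have h3 : ∫ v in (0 : ℝ)..k, F v = ∑ j ∈ range k, ∫ t in (0 : ℝ)..1, F (t + j) := by
    have hadj := sum_integral_adjacent_intervals (a := fun j : ℕ => (j : ℝ)) (n := k)
      (fun j _ => hFint _ _)
    simp only [Nat.cast_zero] at hadj
    rw [← hadj]
    refine sum_congr rfl fun j _ => ?_
    rw [integral_comp_add_right F (j : ℝ), zero_add, Nat.cast_add, Nat.cast_one, add_comm (j : ℝ) 1]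
  have h4 : ∀ j : ℕ, ∀ t : ℝ, F (t + j) = vlog t * Real.cos (2 * π * (t + j) / k) := by
    intro j t; simp only [hF, vlog_add_nat]
  have h5 : ∑ j ∈ range k, ∫ t in (0 : ℝ)..1, F (t + j) =
      ∫ t in (0 : ℝ)..1, vlog t * ∑ j ∈ range k, Real.cos (2 * π * (t + j) / k) := by
    rw [← intervalIntegral.integral_finsetSum (fun j _ => ?_)]
    · refine integral_congr fun t _ => ?_
      simp only [h4, mul_sum]
    · simp only [h4]
      exact (intervalIntegrable_vlog 0 1).mul_continuousOn (Continuous.continuousOn (by fun_prop))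
  rw [h3, h5]
  simp [sum_cos_eq_zero hk]

/-- `∫₀¹ v(x) cos(2πx) dx = −1/2` (integration by parts through `F(x) = sin(2πx) log(2 sin πx)`,
continuous on `[0,1]` with `F(0) = F(1) = 0` and `F' = 2π cos(2πx) v(x) + 2π cos²(πx)` on `(0,1)`).
[cite: Amoroso1996, Prop. 3.1 (the coefficient of cos νt in u(nt))] -/
theorem integral_vlog_mul_cos : ∫ x in (0 : ℝ)..1, vlog x * Real.cos (2 * π * x) = -1 / 2 := by
  set s : ℝ → ℝ := fun x => 2 * Real.sin (π * x) with hs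
  set F : ℝ → ℝ := fun x => Real.cos (π * x) * (s x * Real.log (s x)) with hF
  have hs_cont : Continuous s := by rw [hs]; fun_prop
  have hF_cont : Continuous F := by
    rw [hF]
    exact (by fun_prop : Continuous fun x => Real.cos (π * x)).mul
      (Real.continuous_mul_log.comp hs_cont)
  set f' : ℝ → ℝ := fun x => 2 * π * Real.cos (2 * π * x) * vlog x +
    2 * π * Real.cos (π * x) ^ 2 with hf'
  have hderiv : ∀ x ∈ Set.Ioo (0 : ℝ) 1, HasDerivAt F (f' x) x := by
    intro x hx
    have hsin : 0 < Real.sin (π * x) :=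
      Real.sin_pos_of_pos_of_lt_pi (by nlinarith [Real.pi_pos, hx.1])
        (by nlinarith [Real.pi_pos, hx.2])
    have hsin0 : Real.sin (π * x) ≠ 0 := hsin.ne'
    have hev : F =ᶠ[nhds x] fun y => Real.sin (2 * π * y) * Real.log (s y) := by
      have hopen : IsOpen {y : ℝ | 0 < Real.sin (π * y)} :=
        isOpen_lt continuous_const (by fun_prop)
      filter_upwards [hopen.mem_nhds hsin] with y _
      simp only [hF, hs]
      rw [show 2 * π * y = 2 * (π * y) by ring, Real.sin_two_mul]
      ring
    have h1 : HasDerivAt (fun y => Real.sin (2 * π * y)) (Real.cos (2 * π * x) * (2 * π)) x := by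
      have := ((hasDerivAt_id x).const_mul (2 * π)).sin
      simpa using this
    have h2 : HasDerivAt (fun y => Real.log (s y)) ((2 * (Real.cos (π * x) * π)) / s x) x := by
      have hsd : HasDerivAt s (2 * (Real.cos (π * x) * π)) x := by
        have := (((hasDerivAt_id x).const_mul π).sin).const_mul 2
        simpa [hs] using this
      exact hsd.log (by simp only [hs]; positivity)
    refine ((h1.mul h2).congr_of_eventuallyEq hev).congr_deriv ?_
    simp only [hf', hs, vlog_eq_log_sin, abs_of_pos hsin]
    rw [show 2 * π * x = 2 * (π * x) by ring, Real.sin_two_mul]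
    field_simp
  have hint1 : IntervalIntegrable (fun x => 2 * π * Real.cos (2 * π * x) * vlog x) volume 0 1 :=
    (intervalIntegrable_vlog 0 1).continuousOn_mul
      (Continuous.continuousOn (by fun_prop : Continuous fun x => 2 * π * Real.cos (2 * π * x)))
  have hint2 : IntervalIntegrable (fun x => 2 * π * Real.cos (π * x) ^ 2) volume 0 1 :=
    Continuous.intervalIntegrable (by fun_prop) _ _
  have hint : IntervalIntegrable f' volume 0 1 := by rw [hf']; exact hint1.add hint2
  have hFTC := intervalIntegral.integral_eq_sub_of_hasDerivAt_of_le zero_le_one hF_cont.continuousOn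
    hderiv hint
  have hF0 : F 0 = 0 := by simp [hF, hs]
  have hF1 : F 1 = 0 := by simp [hF, hs]
  rw [hF1, hF0, sub_zero, hf', intervalIntegral.integral_add hint1 hint2] at hFTC
  have hcos2 : ∫ x in (0 : ℝ)..1, 2 * π * Real.cos (π * x) ^ 2 = π := by
    rw [intervalIntegral.integral_const_mul]
    have h := intervalIntegral.integral_comp_mul_left (a := 0) (b := 1) (fun y => Real.cos y ^ 2)
      Real.pi_ne_zero
    rw [mul_zero, mul_one, integral_cos_sq] at h
    rw [h]
    simp only [Real.sin_pi, Real.sin_zero, mul_zero, sub_zero, smul_eq_mul]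
    field_simp
    ring
  have hmain : ∫ x in (0 : ℝ)..1, 2 * π * Real.cos (2 * π * x) * vlog x = -π := by linarith
  have heq : ∫ x in (0 : ℝ)..1, vlog x * Real.cos (2 * π * x) =
      (2 * π)⁻¹ * ∫ x in (0 : ℝ)..1, 2 * π * Real.cos (2 * π * x) * vlog x := by
    rw [← intervalIntegral.integral_const_mul]
    refine integral_congr fun x _ => ?_
    field_simp
  rw [heq, hmain]
  field_simp

/-- **`∫₀¹ g_N(x) cos(2πx) dx = −M(N)/2`**: among the dilates `v(kx)`, `k ≤ N`, only `k = 1` has a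
non-zero first Fourier coefficient. [cite: Amoroso1996, §5 (5.2) (via Prop. 3.1, ε₁ = M(N))] -/
theorem integral_gsum_mul_cos {N : ℕ} (hN : 1 ≤ N) :
    ∫ x in (0 : ℝ)..1, gsum N x * Real.cos (2 * π * x) = -(mertensFunction (N : ℝ) : ℝ) / 2 := by
  have hterm : ∀ k ∈ Icc 1 N, IntervalIntegrable
      (fun x => (mertensFunction ((N : ℝ) / k) : ℝ) * vlog (k * x) * Real.cos (2 * π * x))
      volume 0 1 := by
    intro k hk
    have hk0 : (k : ℝ) ≠ 0 := by have := (mem_Icc.1 hk).1; positivity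
    have h := intervalIntegrable_vlog_affine hk0 0 0 1
    simp only [add_zero] at h
    exact (h.const_mul _).mul_continuousOn (Continuous.continuousOn (by fun_prop))
  have hexp : ∀ x, gsum N x * Real.cos (2 * π * x) =
      ∑ k ∈ Icc 1 N, (mertensFunction ((N : ℝ) / k) : ℝ) * vlog (k * x) *
        Real.cos (2 * π * x) := by
    intro x; rw [gsum, sum_mul]
  simp_rw [hexp]
  have hzero : ∀ b ∈ Icc 1 N, b ≠ 1 →
      ∫ x in (0 : ℝ)..1, (mertensFunction ((N : ℝ) / b) : ℝ) * vlog (b * x) *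
        Real.cos (2 * π * x) = 0 := by
    intro b hb hb1
    have hb2 : 2 ≤ b := by have := (mem_Icc.1 hb).1; omega
    simp_rw [mul_assoc ((mertensFunction ((N : ℝ) / b) : ℝ))]
    rw [intervalIntegral.integral_const_mul, integral_vlog_natMul_mul_cos hb2, mul_zero]
  rw [intervalIntegral.integral_finsetSum hterm, sum_eq_single_of_mem 1 (mem_Icc.2 ⟨le_rfl, hN⟩)
    hzero]
  simp_rw [Nat.cast_one, div_one, one_mul, mul_assoc ((mertensFunction (N : ℝ)) : ℝ)]
  rw [intervalIntegral.integral_const_mul, integral_vlog_mul_cos]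
  ring

/-- `h̃(A_N) ≥ 0`. [folklore] -/
private theorem posLogMahlerMeasure_cyclotomicProduct_nonneg (N : ℕ) :
    0 ≤ posLogMahlerMeasure (cyclotomicProduct N) := by
  rw [posLogMahlerMeasure_cyclotomicProduct_eq]
  exact mul_nonneg (by norm_num)
    (intervalIntegral.integral_nonneg zero_le_one fun _ _ => abs_nonneg _)

/-- **Amoroso's lower bound `|M(N)| ≤ 4 h̃(A_N)`** (RH-FREE; `N ≥ 1`): `|M(N)|/2 = |∫₀¹ g_N cos(2π·)|
≤ ∫₀¹ |g_N| = 2 h̃(A_N)`. [cite: Amoroso1996, §5 (5.2); Prop. 3.1] -/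
private theorem abs_mertensFunction_le_four_mul_posLogMahlerMeasure' {N : ℕ} (hN : 1 ≤ N) :
    |(mertensFunction (N : ℝ) : ℝ)| ≤ 4 * posLogMahlerMeasure (cyclotomicProduct N) := by
  rw [posLogMahlerMeasure_cyclotomicProduct_eq]
  have h := integral_gsum_mul_cos hN
  have hint : IntervalIntegrable (fun x => gsum N x * Real.cos (2 * π * x)) volume 0 1 :=
    (intervalIntegrable_gsum N 0 1).mul_continuousOn (Continuous.continuousOn (by fun_prop))
  have hle : |∫ x in (0 : ℝ)..1, gsum N x * Real.cos (2 * π * x)| ≤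
      ∫ x in (0 : ℝ)..1, |gsum N x| := by
    rw [← Real.norm_eq_abs]
    refine (intervalIntegral.norm_integral_le_integral_norm zero_le_one).trans ?_
    refine intervalIntegral.integral_mono_on zero_le_one hint.norm
      (intervalIntegrable_gsum N 0 1).abs fun x _ => ?_
    rw [Real.norm_eq_abs, abs_mul]
    exact mul_le_of_le_one_right (abs_nonneg _) (Real.abs_cos_le_one _)
  rw [h, abs_div, abs_neg, abs_two] at hle
  linarith

/-! ### §8. The upper bound `h̃(A_N)² = ¼ (∫₀¹|g_N|)² ≤ ¼ ∫₀¹ g_N² ≤ ¼ J₁₁ C² N^{2s} (1 + log N)³`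
under `|M(y)| ≤ C y^s` (Amoroso's (5.3), with Parseval/Franel–Huxley replaced by Edwards'
real-variable evaluation of the Gram matrix `J_{ab}`) -/

/-- Cauchy–Schwarz on `[0,1]` in variance form: `(∫₀¹ |g|)² ≤ ∫₀¹ g²`. [folklore] -/
private theorem sq_integral_abs_le_integral_sq {g : ℝ → ℝ} (hg : IntervalIntegrable g volume 0 1)
    (hg2 : IntervalIntegrable (fun x => g x ^ 2) volume 0 1) :
    (∫ x in (0 : ℝ)..1, |g x|) ^ 2 ≤ ∫ x in (0 : ℝ)..1, g x ^ 2 := by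
  set m := ∫ x in (0 : ℝ)..1, |g x| with hm
  have h0 : 0 ≤ ∫ x in (0 : ℝ)..1, (|g x| - m) ^ 2 :=
    intervalIntegral.integral_nonneg zero_le_one fun _ _ => sq_nonneg _
  have hexp : ∫ x in (0 : ℝ)..1, (|g x| - m) ^ 2 =
      (∫ x in (0 : ℝ)..1, g x ^ 2) - 2 * m * m + m ^ 2 := by
    have he : ∀ x, (|g x| - m) ^ 2 = g x ^ 2 - 2 * m * |g x| + m ^ 2 := fun x => by
      rw [sub_sq, sq_abs]; ring
    simp_rw [he]
    rw [intervalIntegral.integral_add (hg2.sub (hg.abs.const_mul _)) intervalIntegrable_const,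
      intervalIntegral.integral_sub hg2 (hg.abs.const_mul _), intervalIntegral.integral_const_mul,
      intervalIntegral.integral_const]
    simp only [smul_eq_mul, sub_zero, one_mul]
    rw [← hm]
  nlinarith

/-- From `M(x) = O(x^t)` on `ℝ` (`t ≥ 0`) to a bound valid for all real `y ≥ 1`. [folklore] -/
private theorem exists_abs_mertensFunction_le_rpow {t : ℝ} (ht : 0 ≤ t)
    (hM : (fun x : ℝ => (mertensFunction x : ℝ)) =O[atTop] fun x : ℝ => x ^ t) :
    ∃ C : ℝ, 0 ≤ C ∧ ∀ y : ℝ, 1 ≤ y → |(mertensFunction y : ℝ)| ≤ C * y ^ t := by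
  obtain ⟨C, hC0, hC⟩ := hM.exists_pos
  obtain ⟨x₁, hx₁⟩ := eventually_atTop.1 hC.bound
  refine ⟨C + max x₁ 1, by positivity, fun y hy => ?_⟩
  have hy0 : 0 < y := by linarith
  have hyp : 1 ≤ y ^ t := Real.one_le_rpow hy ht
  by_cases hyy : x₁ ≤ y
  · have hb := hx₁ y hyy
    rw [Real.norm_eq_abs, Real.norm_of_nonneg (Real.rpow_nonneg hy0.le _)] at hb
    calc |(mertensFunction y : ℝ)| ≤ C * y ^ t := hb
      _ ≤ (C + max x₁ 1) * y ^ t := by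
          gcongr; exact le_add_of_nonneg_right (by positivity)
  · push Not at hyy
    calc |(mertensFunction y : ℝ)| ≤ y := abs_mertensFunction_le hy0.le
      _ ≤ max x₁ 1 := hyy.le.trans (le_max_left _ _)
      _ ≤ max x₁ 1 * y ^ t := le_mul_of_one_le_right (by positivity) hyp
      _ ≤ (C + max x₁ 1) * y ^ t := by gcongr; linarith

/-- **Upper bound** (Amoroso (5.3)): if `M(x) = O_ε(x^{θ+ε})` for every `ε > 0` (`θ ≥ 1/2`), then
`h̃(A_N) = O_ε(N^{θ+ε})` for every `ε > 0`. [cite: Amoroso1996, §5 (5.3)] -/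
theorem posLogMahlerMeasure_isBigO_of_mertens_isBigO {θ : ℝ} (hθ : 1 / 2 ≤ θ)
    (hM : ∀ ε : ℝ, 0 < ε →
      (fun x : ℝ => (mertensFunction x : ℝ)) =O[atTop] fun x : ℝ => x ^ (θ + ε))
    {ε : ℝ} (hε : 0 < ε) :
    (fun N : ℕ => posLogMahlerMeasure (cyclotomicProduct N)) =O[atTop]
      fun N : ℕ => (N : ℝ) ^ (θ + ε) := by
  set e : ℝ := 2 * ε / 5 with he
  have he0 : 0 < e := by positivity
  set s : ℝ := θ + e with hs
  have hs12 : 1 / 2 ≤ s := by linarith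
  obtain ⟨C, hC0, hC⟩ := exists_abs_mertensFunction_le_rpow (by linarith) (hM e he0)
  have hJ := J_one_one_nonneg
  set K : ℝ := J 1 1 * C ^ 2 * (1 + 1 / e) ^ 3 with hK
  have hK0 : 0 ≤ K := mul_nonneg (mul_nonneg hJ (sq_nonneg C)) (pow_nonneg (by positivity) 3)
  refine IsBigO.of_bound (2⁻¹ * Real.sqrt K) (eventually_atTop.2 ⟨1, fun n hn => ?_⟩)
  have hn' : (1 : ℝ) ≤ n := by exact_mod_cast hn
  have hn0 : (0 : ℝ) < n := by linarith
  have hh0 := posLogMahlerMeasure_cyclotomicProduct_nonneg n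
  rw [Real.norm_of_nonneg hh0, Real.norm_of_nonneg (by positivity)]
  have hsq : posLogMahlerMeasure (cyclotomicProduct n) ^ 2 ≤
      4⁻¹ * (K * (n : ℝ) ^ (2 * (θ + ε))) := by
    rw [posLogMahlerMeasure_cyclotomicProduct_eq, mul_pow]
    have h1 := sq_integral_abs_le_integral_sq (intervalIntegrable_gsum n 0 1)
      (intervalIntegrable_gsum_sq n 0 1)
    have h2 := integral_gsum_sq_le hC0 hs12 hC hn
    have hL : 1 + Real.log n ≤ (1 + 1 / e) * (n : ℝ) ^ e := by
      have h1 : Real.log n ≤ (n : ℝ) ^ e / e := Real.log_le_rpow_div hn0.le he0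
      have h2 : 1 ≤ (n : ℝ) ^ e := Real.one_le_rpow hn' he0.le
      have : (1 + 1 / e) * (n : ℝ) ^ e = (n : ℝ) ^ e + (n : ℝ) ^ e / e := by ring
      rw [this]; linarith
    have hlog : 0 ≤ 1 + Real.log n := by have := Real.log_nonneg hn'; linarith
    have hL3 : (1 + Real.log n) ^ 3 ≤ (1 + 1 / e) ^ 3 * (n : ℝ) ^ (3 * e) := by
      calc (1 + Real.log n) ^ 3 ≤ ((1 + 1 / e) * (n : ℝ) ^ e) ^ 3 := pow_le_pow_left₀ hlog hL 3
        _ = (1 + 1 / e) ^ 3 * ((n : ℝ) ^ e) ^ 3 := by ring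
        _ = (1 + 1 / e) ^ 3 * (n : ℝ) ^ (3 * e) := by
            rw [← Real.rpow_natCast ((n : ℝ) ^ e) 3, ← Real.rpow_mul hn0.le]
            congr 1; push_cast; ring
    have hexp : (n : ℝ) ^ (2 * s) * (n : ℝ) ^ (3 * e) = (n : ℝ) ^ (2 * (θ + ε)) := by
      rw [← Real.rpow_add hn0]; congr 1; rw [hs, he]; ring
    have hpos : 0 ≤ J 1 1 * C ^ 2 * (n : ℝ) ^ (2 * s) :=
      mul_nonneg (mul_nonneg hJ (sq_nonneg C)) (Real.rpow_nonneg hn0.le _)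
    calc (2⁻¹ : ℝ) ^ 2 * (∫ x in (0 : ℝ)..1, |gsum n x|) ^ 2
        ≤ (2⁻¹ : ℝ) ^ 2 * (J 1 1 * C ^ 2 * (n : ℝ) ^ (2 * s) * (1 + Real.log n) ^ 3) :=
          mul_le_mul_of_nonneg_left (h1.trans h2) (by positivity)
      _ ≤ (2⁻¹ : ℝ) ^ 2 *
          (J 1 1 * C ^ 2 * (n : ℝ) ^ (2 * s) * ((1 + 1 / e) ^ 3 * (n : ℝ) ^ (3 * e))) :=
          mul_le_mul_of_nonneg_left (mul_le_mul_of_nonneg_left hL3 hpos) (by positivity)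
      _ = 4⁻¹ * (K * (n : ℝ) ^ (2 * (θ + ε))) := by rw [hK, ← hexp]; ring
  have hrhs : 4⁻¹ * (K * (n : ℝ) ^ (2 * (θ + ε))) =
      (2⁻¹ * Real.sqrt K * (n : ℝ) ^ (θ + ε)) ^ 2 := by
    rw [mul_pow, mul_pow, Real.sq_sqrt hK0, ← Real.rpow_natCast ((n : ℝ) ^ (θ + ε)) 2,
      ← Real.rpow_mul hn0.le]
    norm_num
    ring_nf
  rw [hrhs] at hsq
  exact (pow_le_pow_iff_left₀ hh0 (by positivity) two_ne_zero).1 hsq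

/-! ### §9. Assembly with the Mertens-function dictionary (Littlewood 1912; Titchmarsh Thm 14.25
(A) ⟺ (C)): tree `mertens_isBigO_of_quasiRiemannHypothesis_holds`,
`quasiRiemannHypothesis_of_mertens_isBigO_holds` -/

/-- **Zero-free half-plane ⟹ `h̃(A_N) ≪ N^{λ+ε}`** (`1/2 ≤ λ < 1`). [cite: Amoroso1996, Thm. 1.3 (⟹);
Bordelles2020ArithmeticTales Thm 3.55 (⟸)] -/
theorem posLogMahlerMeasure_isBigO_of_zeroFree {lam : ℝ} (h0 : 1 / 2 ≤ lam) (h1 : lam < 1)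
    (hZ : ∀ s : ℂ, lam < s.re → riemannZeta s ≠ 0) {ε : ℝ} (hε : 0 < ε) :
    (fun N : ℕ => posLogMahlerMeasure (cyclotomicProduct N)) =O[atTop]
      fun N : ℕ => (N : ℝ) ^ (lam + ε) :=
  posLogMahlerMeasure_isBigO_of_mertens_isBigO h0
    (mertens_isBigO_of_quasiRiemannHypothesis_holds lam h0 h1
      ((forall_riemannZeta_ne_zero_iff_quasiRiemannHypothesis lam).1 hZ)) hε

/-- **`h̃(A_N) ≪ N^t` ⟹ `M(x) ≪ x^t`** (`t ≥ 0`), by `|M(N)| ≤ 4 h̃(A_N)` and `M(x) = M(⌊x⌋)`.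
[cite: Amoroso1996, §5 (5.2)] -/
theorem mertens_isBigO_of_posLogMahlerMeasure_isBigO {t : ℝ} (ht : 0 ≤ t)
    (h : (fun N : ℕ => posLogMahlerMeasure (cyclotomicProduct N)) =O[atTop]
      fun N : ℕ => (N : ℝ) ^ t) :
    (fun x : ℝ => (mertensFunction x : ℝ)) =O[atTop] fun x : ℝ => x ^ t := by
  obtain ⟨c, hc0, hc⟩ := h.exists_pos
  obtain ⟨N₀, hN₀⟩ := eventually_atTop.1 hc.bound
  refine IsBigO.of_bound (4 * c) (eventually_atTop.2 ⟨((max N₀ 1 : ℕ) : ℝ), fun x hx => ?_⟩)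
  set n := ⌊x⌋₊ with hn
  have hx1 : (1 : ℝ) ≤ x := le_trans (by exact_mod_cast le_max_right N₀ 1) hx
  have hx0 : 0 ≤ x := by linarith
  have hnN : max N₀ 1 ≤ n := Nat.le_floor hx
  have hn1 : 1 ≤ n := le_trans (le_max_right _ _) hnN
  have hnx : (n : ℝ) ≤ x := Nat.floor_le hx0
  have hMx : (mertensFunction x : ℝ) = mertensFunction (n : ℝ) := by
    simp only [mertensFunction, hn, Nat.floor_natCast]
  have hb := hN₀ n (le_trans (le_max_left _ _) hnN)
  rw [Real.norm_eq_abs, Real.norm_of_nonneg (Real.rpow_nonneg (Nat.cast_nonneg _) _)] at hb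
  have hb' : posLogMahlerMeasure (cyclotomicProduct n) ≤ c * (n : ℝ) ^ t := (le_abs_self _).trans hb
  rw [Real.norm_eq_abs, hMx, Real.norm_of_nonneg (Real.rpow_nonneg hx0 _)]
  calc |(mertensFunction (n : ℝ) : ℝ)| ≤ 4 * posLogMahlerMeasure (cyclotomicProduct n) :=
        abs_mertensFunction_le_four_mul_posLogMahlerMeasure' hn1
    _ ≤ 4 * (c * (n : ℝ) ^ t) := by gcongr
    _ ≤ 4 * (c * x ^ t) := by gcongr
    _ = 4 * c * x ^ t := by ring

/-- **`h̃(A_N) ≪_ε N^{λ+ε}` ⟹ `ζ(s) ≠ 0` for `Re s > λ`** (`λ ≥ 1/2`; via Littlewood's converse dictionary at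
the abscissae `θ' ∈ (λ, 1)`). [cite: Amoroso1996, Thm. 1.3 (⟸); Bordelles2020ArithmeticTales Thm 3.55 (⟹)] -/
theorem zeroFree_of_posLogMahlerMeasure_isBigO {lam : ℝ} (h0 : 1 / 2 ≤ lam)
    (h : ∀ ε : ℝ, 0 < ε → (fun N : ℕ => posLogMahlerMeasure (cyclotomicProduct N)) =O[atTop]
      fun N : ℕ => (N : ℝ) ^ (lam + ε)) :
    ∀ s : ℂ, lam < s.re → riemannZeta s ≠ 0 := by
  intro s hs
  by_cases h1 : s.re < 1
  · set θ' := (lam + s.re) / 2 with hθ'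
    have hθ'0 : 0 < θ' := by rw [hθ']; linarith
    have hθ'1 : θ' < 1 := by rw [hθ']; linarith
    have hM := mertens_isBigO_of_posLogMahlerMeasure_isBigO (by linarith) (h (θ' - lam) (by linarith))
    rw [show lam + (θ' - lam) = θ' by ring] at hM
    have hQ := quasiRiemannHypothesis_of_mertens_isBigO_holds θ' hθ'0 hθ'1 hM
    exact fun hz => hQ s hz (by rw [hθ']; linarith) h1
  · exact fun hz => riemannZeta_ne_zero_of_one_le_re (not_lt.1 h1) hz

end AmorosoProofs

/-! ### The discharges -/

open AmorosoProofs

/-- **Amoroso's RH-FREE lower bound `|M(N)| ≤ 4 h̃(Φ₁⋯Φ_N)`** for `N ≥ 1` (`M` the Mertens function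
`mertensFunction`, `h̃ = posLogMahlerMeasure`): the first Fourier coefficient of
`log|A_N(e^{it})| = ∑_{m≤N} M(N/m) log|1 − e^{imt}|` is `−M(N)/2`, and `∫ |log|A_N|| = 4π h̃(A_N)`
since the Mahler measure of `A_N` is `1`. [cite: Amoroso1996, §5 (5.2); §3 (Prop. 3.1, ∫|log|R|| = 4h̃(R))] -/
theorem abs_mertensFunction_le_four_mul_posLogMahlerMeasure {N : ℕ} (hN : 1 ≤ N) :
    |(mertensFunction (N : ℝ) : ℝ)| ≤ 4 * posLogMahlerMeasure (cyclotomicProduct N) :=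
  abs_mertensFunction_le_four_mul_posLogMahlerMeasure' hN

/-- **`m(Φ₁⋯Φ_N) = 0`**: the logarithmic Mahler measure of the product of the first `N` cyclotomic
polynomials vanishes (monic, all zeros on the unit circle — Amoroso §2: for `R` with all zeros and poles
on the unit circle `h̃(R)` reduces to `½ · (1/2π)∫|log|R(e^{it})||`).
[cite: Amoroso1996, §2 (rational functions with all zeros and poles on the unit circle)] -/
theorem logMahlerMeasure_cyclotomicProduct_eq_zero (N : ℕ) :
    (cyclotomicProduct N).logMahlerMeasure = 0 :=
  logMahlerMeasure_cyclotomicProduct N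

/-- **Amoroso's criterion on the closed range `1/2 ≤ λ < 1`, PROVED**: (`∀ ε > 0`,
`h̃(A_N) = O_ε(N^{λ+ε})`) iff `ζ(s) ≠ 0` for `Re s > λ`. The case `λ = 1/2` is Amoroso 1996 Thm 1.3,
the open range is Broughan Vol. 2 Thm 7.6 / Bordellès Thm 3.55.
[cite: Amoroso1996, Thm. 1.3; Bordelles2020ArithmeticTales Thm 3.55] -/
theorem posLogMahlerMeasure_isBigO_iff_forall_riemannZeta_ne_zero {lam : ℝ} (h0 : 1 / 2 ≤ lam)
    (h1 : lam < 1) :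
    (∀ ε : ℝ, 0 < ε →
        (fun N : ℕ => posLogMahlerMeasure (cyclotomicProduct N)) =O[atTop]
          fun N : ℕ => (N : ℝ) ^ (lam + ε)) ↔
      ∀ s : ℂ, lam < s.re → riemannZeta s ≠ 0 :=
  ⟨fun h => zeroFree_of_posLogMahlerMeasure_isBigO h0 h,
    fun hZ _ hε => posLogMahlerMeasure_isBigO_of_zeroFree h0 h1 hZ hε⟩

/-- **DISCHARGE of the named fact `Amoroso1995_criterion`** (Broughan Vol. 2 **Thm 7.6**, the
"Amoroso criterion"; Amoroso, Rend. Sem. Mat. Univ. Politec. Torino 53 (1995); Bordellès,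
*Arithmetic Tales* Thm 3.55): for `1/2 < λ < 1`, `h̃(A_N) ≪_ε N^{λ+ε}` iff `ζ(s) ≠ 0` on `Re s > λ`.
A KERNEL EQUIVALENCE; standard axioms. [cite: Bordelles2020ArithmeticTales, Thm 3.55; Broughan2017 Vol. 2 Thm 7.6] -/
theorem Amoroso1995_criterion_holds : Amoroso1995_criterion := fun _ h0 h1 =>
  posLogMahlerMeasure_isBigO_iff_forall_riemannZeta_ne_zero h0.le h1

/-- **DISCHARGE of the named fact `Amoroso1996_thm_1_3`** (F. Amoroso, J. Number Theory 60 (1996),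
**Thm 1.3**: "the statement `h̃(Φ) ≪ N^{1/2+ε}` for any `ε > 0` is equivalent to the Riemann
hypothesis"). A KERNEL EQUIVALENCE; standard axioms. [cite: Amoroso1996, Thm. 1.3] -/
theorem Amoroso1996_thm_1_3_holds : Amoroso1996_thm_1_3 := by
  rw [Amoroso1996_thm_1_3, riemannHypothesis_iff_forall_riemannZeta_ne_zero]
  exact (posLogMahlerMeasure_isBigO_iff_forall_riemannZeta_ne_zero le_rfl (by norm_num)).symm

/-- **RH ⟺ `h̃(Φ₁⋯Φ_N) ≪_ε N^{1/2+ε}`** — Amoroso's Theorem 1.3 as a tree equivalence with Mathlib's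
`RiemannHypothesis` on the left. [cite: Amoroso1996, Thm. 1.3] -/
theorem riemannHypothesis_iff_posLogMahlerMeasure_cyclotomicProduct_isBigO :
    RiemannHypothesis ↔
      ∀ ε : ℝ, 0 < ε →
        (fun N : ℕ => posLogMahlerMeasure (cyclotomicProduct N)) =O[atTop]
          fun N : ℕ => (N : ℝ) ^ (1 / 2 + ε) :=
  Amoroso1996_thm_1_3_holds

namespace AmorosoProofs

/-! ### §10. Broughan Vol. 2 Thm 7.7 (Amoroso 1995): the ONE-SIDED derivative criterion.
A lower bound `log|A_N'(ζ)| ≥ −C N^λ` at every root `ζ` of `A_N` forces `h̃(A_N) ≤ |C| N^λ + O(log N)`,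
hence (§9, the easy half of Thm 7.6) `ζ(s) ≠ 0` on `Re s > λ`. The 1995 source (Rend. Sem. Mat. Univ.
Politec. Torino 53) is not held; the route below is ours: Lagrange interpolation of the constant `1`
at the roots of `A_N` (Mathlib's first barycentric form `Lagrange.eval_interpolate_not_at_node`) gives
`1/|A_N(z)| ≤ e^{CN^λ} ∑_μ 1/|z − μ|`, whence
`log⁺(1/|A_N(z)|) ≤ log⁺ e^{CN^λ} + log⁺ K + log d + ∑_μ log⁺(1/(K|z − μ|))` (`d = deg A_N ≤ N²`), and
`∫₀¹ log⁺(1/(K|e(x) − μ|)) dx ≤ 4/√K`; with `K = N⁴` and `∫ log|A_N| = 0`: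
`h̃(A_N) = ∫₀¹ log⁺(1/|A_N(e(x))|) dx ≤ |C| N^λ + 6 log N + 4`. -/

/-- The roots of `A_N`: the primitive `n`-th roots of unity, `1 ≤ n ≤ N`. [folklore] -/
def rootSet (N : ℕ) : Finset ℂ := (Icc 1 N).biUnion fun n => primitiveRoots n ℂ

/-- Membership in `rootSet`. [folklore] -/
private theorem mem_rootSet {N : ℕ} {μ : ℂ} :
    μ ∈ rootSet N ↔ ∃ n, 1 ≤ n ∧ n ≤ N ∧ IsPrimitiveRoot μ n := by
  simp only [rootSet, Finset.mem_biUnion, mem_Icc]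
  constructor
  · rintro ⟨n, ⟨h1, h2⟩, h⟩; exact ⟨n, h1, h2, (mem_primitiveRoots (by omega)).1 h⟩
  · rintro ⟨n, h1, h2, h⟩; exact ⟨n, ⟨h1, h2⟩, (mem_primitiveRoots (by omega)).2 h⟩

/-- Elements of `rootSet N` are roots of unity of order `≤ N`. [folklore] -/
private theorem pow_eq_one_of_mem_rootSet {N : ℕ} {μ : ℂ} (h : μ ∈ rootSet N) :
    ∃ m : ℕ, 1 ≤ m ∧ m ≤ N ∧ μ ^ m = 1 := by
  obtain ⟨n, h1, h2, h⟩ := mem_rootSet.1 h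
  exact ⟨n, h1, h2, h.pow_eq_one⟩

/-- Elements of `rootSet N` lie on the unit circle. [folklore] -/
private theorem norm_eq_one_of_mem_rootSet {N : ℕ} {μ : ℂ} (h : μ ∈ rootSet N) : ‖μ‖ = 1 := by
  obtain ⟨n, h1, -, h⟩ := mem_rootSet.1 h
  exact Complex.norm_eq_one_of_pow_eq_one h.pow_eq_one (by omega)

/-- `1 ∈ rootSet N` for `N ≥ 1`. [folklore] -/
private theorem one_mem_rootSet {N : ℕ} (hN : 1 ≤ N) : (1 : ℂ) ∈ rootSet N :=
  mem_rootSet.2 ⟨1, le_rfl, hN, IsPrimitiveRoot.one⟩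

/-- `#rootSet N ≤ N²`. [folklore] -/
private theorem card_rootSet_le (N : ℕ) : (rootSet N).card ≤ N * N := by
  unfold rootSet
  refine Finset.card_biUnion_le.trans ?_
  calc ∑ n ∈ Icc 1 N, (primitiveRoots n ℂ).card ≤ ∑ n ∈ Icc 1 N, N :=
        sum_le_sum fun n hn => by
          have hn' := mem_Icc.1 hn
          rw [(Complex.isPrimitiveRoot_exp n (by omega)).card_primitiveRoots]
          exact (Nat.totient_le n).trans hn'.2
    _ = N * N := by simp

/-- `A_N = ∏_{μ ∈ rootSet N} (X − μ)` (Lagrange's nodal polynomial of the root set). [folklore] -/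
private theorem cyclotomicProduct_eq_nodal (N : ℕ) :
    cyclotomicProduct N = Lagrange.nodal (rootSet N) id := by
  rw [Lagrange.nodal_eq, rootSet, Finset.prod_biUnion]
  · unfold cyclotomicProduct
    refine prod_congr rfl fun n hn => ?_
    exact cyclotomic_eq_prod_X_sub_primitiveRoots
      (Complex.isPrimitiveRoot_exp n (by have := (mem_Icc.1 hn).1; omega))
  · intro n hn m hm hnm
    simp only [Function.onFun]
    rw [Finset.disjoint_left]
    intro μ hμn hμm
    have hn1 := (mem_Icc.1 (Finset.mem_coe.1 hn)).1
    have hm1 := (mem_Icc.1 (Finset.mem_coe.1 hm)).1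
    exact hnm (((mem_primitiveRoots (by omega)).1 hμn).unique
      ((mem_primitiveRoots (by omega)).1 hμm))

/-- For irrational `x`, `e(x)` is not a root of `A_N`. [folklore] -/
private theorem circ_ne_of_mem_rootSet {x : ℝ} (hx : Irrational x) {N : ℕ} {μ : ℂ}
    (hμ : μ ∈ rootSet N) : circ x ≠ μ := by
  obtain ⟨n, h1, -, h⟩ := mem_rootSet.1 hμ
  intro he
  apply circ_pow_ne_one_of_irrational hx h1
  rw [he]
  exact h.pow_eq_one

/-- **Lagrange lower bound**: if `log|A_N'(μ)| ≥ −L` at every root `μ` of `A_N`, then for `z` off the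
root set `1/|A_N(z)| ≤ e^L ∑_μ 1/|z − μ|` (first barycentric form of the interpolant of `1`).
[folklore] -/
private theorem inv_norm_eval_le {N : ℕ} (hN : 1 ≤ N) {L : ℝ}
    (hL : ∀ μ ∈ rootSet N, -L ≤ Real.log ‖eval μ (derivative (cyclotomicProduct N))‖)
    {z : ℂ} (hz : ∀ μ ∈ rootSet N, z ≠ μ) :
    ‖eval z (cyclotomicProduct N)‖⁻¹ ≤ Real.exp L * ∑ μ ∈ rootSet N, ‖z - μ‖⁻¹ := by
  classical
  set S := rootSet N with hS
  have hinj : Set.InjOn (id : ℂ → ℂ) S := Set.injOn_id _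
  have hne : S.Nonempty := ⟨1, one_mem_rootSet hN⟩
  have hz' : ∀ i ∈ S, z ≠ id i := fun i hi => hz i hi
  have h1 := Lagrange.eval_interpolate_not_at_node (s := S) (v := id) 1 hz'
  rw [Lagrange.interpolate_one hinj hne, eval_one, ← cyclotomicProduct_eq_nodal] at h1
  have hA0 : eval z (cyclotomicProduct N) ≠ 0 := by
    intro h0; rw [h0, zero_mul] at h1; exact one_ne_zero h1
  have hder : ∀ μ ∈ S, ‖Lagrange.nodalWeight S id μ‖ ≤ Real.exp L := by
    intro μ hμ
    have hw := Lagrange.nodalWeight_ne_zero hinj hμ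
    rw [Lagrange.nodalWeight_eq_eval_derivative_nodal hμ, ← cyclotomicProduct_eq_nodal] at hw ⊢
    have hw' : eval (id μ) (derivative (cyclotomicProduct N)) ≠ 0 := fun h => hw (by rw [h, inv_zero])
    have hpos : 0 < ‖eval (id μ) (derivative (cyclotomicProduct N))‖ := norm_pos_iff.2 hw'
    have hge : Real.exp (-L) ≤ ‖eval (id μ) (derivative (cyclotomicProduct N))‖ := by
      rw [← Real.exp_log hpos]
      exact Real.exp_le_exp.2 (hL μ hμ)
    rw [norm_inv]
    calc ‖eval (id μ) (derivative (cyclotomicProduct N))‖⁻¹ ≤ (Real.exp (-L))⁻¹ :=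
          inv_anti₀ (Real.exp_pos _) hge
      _ = Real.exp L := by rw [Real.exp_neg, inv_inv]
  have h2 : (1 : ℝ) ≤ ‖eval z (cyclotomicProduct N)‖ * (Real.exp L * ∑ μ ∈ S, ‖z - μ‖⁻¹) := by
    calc (1 : ℝ) = ‖(1 : ℂ)‖ := by simp
      _ = ‖eval z (cyclotomicProduct N) *
            ∑ i ∈ S, Lagrange.nodalWeight S id i * (z - id i)⁻¹ * (1 : ℂ → ℂ) i‖ := by rw [← h1]
      _ ≤ ‖eval z (cyclotomicProduct N)‖ * ∑ i ∈ S, ‖Lagrange.nodalWeight S id i‖ * ‖z - i‖⁻¹ := by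
          rw [norm_mul]
          refine mul_le_mul_of_nonneg_left ((norm_sum_le _ _).trans (sum_le_sum fun i _ => ?_))
            (norm_nonneg _)
          simp only [Pi.one_apply, mul_one, norm_mul, norm_inv, id]
          rfl
      _ ≤ ‖eval z (cyclotomicProduct N)‖ * ∑ i ∈ S, Real.exp L * ‖z - i‖⁻¹ := by
          refine mul_le_mul_of_nonneg_left (sum_le_sum fun i hi => ?_) (norm_nonneg _)
          exact mul_le_mul_of_nonneg_right (hder i hi) (inv_nonneg.2 (norm_nonneg _))
      _ = ‖eval z (cyclotomicProduct N)‖ * (Real.exp L * ∑ μ ∈ S, ‖z - μ‖⁻¹) := by rw [← mul_sum]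
  have ha : 0 < ‖eval z (cyclotomicProduct N)‖ := norm_pos_iff.2 hA0
  calc ‖eval z (cyclotomicProduct N)‖⁻¹ = ‖eval z (cyclotomicProduct N)‖⁻¹ * 1 := by ring
    _ ≤ ‖eval z (cyclotomicProduct N)‖⁻¹ *
        (‖eval z (cyclotomicProduct N)‖ * (Real.exp L * ∑ μ ∈ S, ‖z - μ‖⁻¹)) :=
        mul_le_mul_of_nonneg_left h2 (inv_nonneg.2 ha.le)
    _ = Real.exp L * ∑ μ ∈ S, ‖z - μ‖⁻¹ := by field_simp

/-- The pointwise bound off the root set: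
`log⁺(1/|A_N(z)|) ≤ log⁺ e^L + log⁺ K + log #S + ∑_{μ∈S} log⁺(1/(K|z − μ|))` (`K > 0`). [folklore] -/
private theorem posLog_inv_norm_eval_le {N : ℕ} (hN : 1 ≤ N) {L K : ℝ} (hK : 0 < K)
    (hL : ∀ μ ∈ rootSet N, -L ≤ Real.log ‖eval μ (derivative (cyclotomicProduct N))‖)
    {z : ℂ} (hz : ∀ μ ∈ rootSet N, z ≠ μ) :
    Real.posLog ‖eval z (cyclotomicProduct N)‖⁻¹ ≤
      Real.posLog (Real.exp L) + Real.posLog K + Real.log (rootSet N).card +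
        ∑ μ ∈ rootSet N, Real.posLog (K * ‖z - μ‖)⁻¹ := by
  have h1 := inv_norm_eval_le hN hL hz
  have hsum : Real.exp L * ∑ μ ∈ rootSet N, ‖z - μ‖⁻¹ =
      Real.exp L * (K * ∑ μ ∈ rootSet N, (K * ‖z - μ‖)⁻¹) := by
    congr 1
    rw [mul_sum]
    refine sum_congr rfl fun μ _ => ?_
    rw [mul_inv, ← mul_assoc, mul_inv_cancel₀ hK.ne', one_mul]
  calc Real.posLog ‖eval z (cyclotomicProduct N)‖⁻¹
      ≤ Real.posLog (Real.exp L * (K * ∑ μ ∈ rootSet N, (K * ‖z - μ‖)⁻¹)) := by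
        rw [← hsum]; exact Real.posLog_le_posLog (by positivity) h1
    _ ≤ Real.posLog (Real.exp L) + Real.posLog (K * ∑ μ ∈ rootSet N, (K * ‖z - μ‖)⁻¹) :=
        Real.posLog_mul
    _ ≤ Real.posLog (Real.exp L) +
          (Real.posLog K + Real.posLog (∑ μ ∈ rootSet N, (K * ‖z - μ‖)⁻¹)) := by
        gcongr; exact Real.posLog_mul
    _ ≤ Real.posLog (Real.exp L) + (Real.posLog K +
          (Real.log (rootSet N).card + ∑ μ ∈ rootSet N, Real.posLog (K * ‖z - μ‖)⁻¹)) := by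
        gcongr; exact Real.posLog_sum _ _
    _ = _ := by ring

/-- The kernel `G_K(x) = log⁺(1/(K|e(x) − 1|))`. [folklore] -/
private def glog (K : ℝ) (x : ℝ) : ℝ := Real.posLog (K * ‖circ x - 1‖)⁻¹

/-- `G_K` is `1`-periodic. [folklore] -/
private theorem glog_periodic (K : ℝ) : Function.Periodic (glog K) 1 := fun x => by
  unfold glog
  rw [show x + 1 = x + ((1 : ℤ) : ℝ) by simp, circ_add_int]

/-- `G_K` is measurable. [folklore] -/
private theorem measurable_glog (K : ℝ) : Measurable (glog K) := by
  unfold glog circ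
  exact Real.continuous_posLog.measurable.comp
    ((measurable_const.mul (Continuous.measurable (by fun_prop))).inv)

/-- `log⁺ y ≤ 2 √y` for `y ≥ 0`. [folklore] -/
private theorem posLog_le_two_mul_sqrt {y : ℝ} (hy : 0 ≤ y) : Real.posLog y ≤ 2 * y ^ (1 / 2 : ℝ) := by
  rw [Real.posLog_apply, max_le_iff]
  refine ⟨by positivity, ?_⟩
  have h := Real.log_le_rpow_div hy (by norm_num : (0 : ℝ) < 1 / 2)
  have : y ^ (1 / 2 : ℝ) / (1 / 2) = 2 * y ^ (1 / 2 : ℝ) := by ring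
  linarith

/-- The majorant `G_K(x) ≤ K^{−1/2} (x^{−1/2} + (1 − x)^{−1/2})` on `(0, 1)`. [folklore] -/
private theorem glog_le {K : ℝ} (hK : 0 < K) {x : ℝ} (h0 : 0 < x) (h1 : x < 1) :
    glog K x ≤ K ^ (-(1 / 2 : ℝ)) * (x ^ (-(1 / 2 : ℝ)) + (1 - x) ^ (-(1 / 2 : ℝ))) := by
  unfold glog
  have hsin : 0 < Real.sin (π * x) :=
    Real.sin_pos_of_pos_of_lt_pi (by positivity) (by nlinarith [Real.pi_pos])
  rw [norm_circ_sub_one, abs_of_pos hsin]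
  set m := min x (1 - x) with hm
  have hm0 : 0 < m := lt_min h0 (by linarith)
  have hsm : 4 * m ≤ 2 * Real.sin (π * x) := by
    have := two_mul_min_le_sin h0.le h1.le; rw [← hm] at this; linarith
  have hy : (K * (2 * Real.sin (π * x)))⁻¹ ≤ (4 * K * m)⁻¹ :=
    inv_anti₀ (by positivity) (by nlinarith)
  have hKr : 0 < K ^ (-(1 / 2 : ℝ)) := Real.rpow_pos_of_pos hK _
  have h4 : (4 : ℝ) ^ (1 / 2 : ℝ) = 2 := by
    rw [← Real.sqrt_eq_rpow, show (4 : ℝ) = 2 ^ 2 by norm_num, Real.sqrt_sq (by norm_num)]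
  calc Real.posLog (K * (2 * Real.sin (π * x)))⁻¹
      ≤ Real.posLog (4 * K * m)⁻¹ := Real.posLog_le_posLog (by positivity) hy
    _ ≤ 2 * ((4 * K * m)⁻¹) ^ (1 / 2 : ℝ) := posLog_le_two_mul_sqrt (by positivity)
    _ = K ^ (-(1 / 2 : ℝ)) * m ^ (-(1 / 2 : ℝ)) := by
        rw [Real.inv_rpow (by positivity), Real.mul_rpow (by positivity) hm0.le,
          Real.mul_rpow (by norm_num) hK.le, h4, Real.rpow_neg hK.le, Real.rpow_neg hm0.le]
        have h2 : 0 < K ^ (1 / 2 : ℝ) := Real.rpow_pos_of_pos hK _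
        have h3 : 0 < m ^ (1 / 2 : ℝ) := Real.rpow_pos_of_pos hm0 _
        field_simp
    _ ≤ K ^ (-(1 / 2 : ℝ)) * (x ^ (-(1 / 2 : ℝ)) + (1 - x) ^ (-(1 / 2 : ℝ))) := by
        refine mul_le_mul_of_nonneg_left ?_ hKr.le
        have hxr : 0 < x ^ (-(1 / 2 : ℝ)) := Real.rpow_pos_of_pos h0 _
        have h1xr : 0 < (1 - x) ^ (-(1 / 2 : ℝ)) := Real.rpow_pos_of_pos (by linarith) _
        rcases min_choice x (1 - x) with h | h <;> rw [hm, h] <;> linarith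

/-- The majorant is integrable on `[0,1]` with integral `4 K^{−1/2}`. [folklore] -/
private theorem integral_majorant (K : ℝ) :
    IntervalIntegrable (fun x : ℝ => K ^ (-(1 / 2 : ℝ)) * (x ^ (-(1 / 2 : ℝ)) + (1 - x) ^ (-(1 / 2 : ℝ))))
      volume 0 1 ∧
    ∫ x in (0 : ℝ)..1, K ^ (-(1 / 2 : ℝ)) * (x ^ (-(1 / 2 : ℝ)) + (1 - x) ^ (-(1 / 2 : ℝ))) =
      4 * K ^ (-(1 / 2 : ℝ)) := by
  have hi1 : IntervalIntegrable (fun x : ℝ => x ^ (-(1 / 2 : ℝ))) volume 0 1 :=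
    intervalIntegral.intervalIntegrable_rpow' (by norm_num)
  have hi2 : IntervalIntegrable (fun x : ℝ => (1 - x) ^ (-(1 / 2 : ℝ))) volume 0 1 := by
    have h := (intervalIntegral.intervalIntegrable_rpow' (a := 1) (b := 0) (r := -(1 / 2 : ℝ))
      (by norm_num)).comp_sub_left 1
    simpa using h
  refine ⟨(hi1.add hi2).const_mul _, ?_⟩
  have hI1 : ∫ x in (0 : ℝ)..1, x ^ (-(1 / 2 : ℝ)) = 2 := by
    rw [integral_rpow (Or.inl (by norm_num))]; norm_num
  have hI2 : ∫ x in (0 : ℝ)..1, (1 - x) ^ (-(1 / 2 : ℝ)) = 2 := by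
    have h := intervalIntegral.integral_comp_sub_left (fun x : ℝ => x ^ (-(1 / 2 : ℝ))) (1 : ℝ)
      (a := 0) (b := 1)
    rw [sub_self, sub_zero] at h
    rw [h, hI1]
  rw [intervalIntegral.integral_const_mul, intervalIntegral.integral_add hi1 hi2, hI1, hI2]
  ring

/-- `G_K ∈ L¹_loc` (`K > 0`). [folklore] -/
private theorem intervalIntegrable_glog {K : ℝ} (hK : 0 < K) (a b : ℝ) :
    IntervalIntegrable (glog K) volume a b := by
  refine (glog_periodic K).intervalIntegrable₀ one_ne_zero ?_ a b
  refine (integral_majorant K).1.mono_fun' (measurable_glog K).aestronglyMeasurable ?_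
  rw [Filter.EventuallyLE, ae_restrict_iff' measurableSet_uIoc]
  refine Filter.Eventually.of_forall fun x hx => ?_
  rw [Set.uIoc_of_le zero_le_one] at hx
  have hg0 : 0 ≤ glog K x := Real.posLog_nonneg
  rw [Real.norm_eq_abs, abs_of_nonneg hg0]
  rcases eq_or_lt_of_le hx.2 with h | h
  · rw [h]
    have hc : circ 1 = 1 := by exact_mod_cast circ_int 1
    simp only [glog, hc, sub_self, norm_zero, mul_zero, inv_zero, Real.posLog_zero,
      Real.zero_rpow (show (-(1 / 2 : ℝ)) ≠ 0 by norm_num), add_zero, Real.one_rpow]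
    positivity
  · exact glog_le hK hx.1 h

/-- **`∫₀¹ log⁺(1/(K|e(x) − 1|)) dx ≤ 4/√K`**. [folklore] -/
private theorem integral_glog_le {K : ℝ} (hK : 0 < K) :
    ∫ x in (0 : ℝ)..1, glog K x ≤ 4 * K ^ (-(1 / 2 : ℝ)) := by
  rw [← (integral_majorant K).2]
  refine intervalIntegral.integral_mono_on zero_le_one (intervalIntegrable_glog hK 0 1)
    (integral_majorant K).1 fun x hx => ?_
  rcases eq_or_lt_of_le hx.1 with h0 | h0
  · rw [← h0]
    have hc : circ 0 = 1 := by exact_mod_cast circ_int 0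
    simp only [glog, hc, sub_self, norm_zero, mul_zero, inv_zero, Real.posLog_zero,
      Real.zero_rpow (show (-(1 / 2 : ℝ)) ≠ 0 by norm_num), zero_add, sub_zero, Real.one_rpow]
    positivity
  rcases eq_or_lt_of_le hx.2 with h1 | h1
  · rw [h1]
    have hc : circ 1 = 1 := by exact_mod_cast circ_int 1
    simp only [glog, hc, sub_self, norm_zero, mul_zero, inv_zero, Real.posLog_zero,
      Real.zero_rpow (show (-(1 / 2 : ℝ)) ≠ 0 by norm_num), add_zero, Real.one_rpow]
    positivity
  exact glog_le hK h0 h1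

/-- Rotation: for `|μ| = 1` there is `θ` with `log⁺(1/(K|e(x) − μ|)) = G_K(x − θ)`. [folklore] -/
private theorem exists_rotation (K : ℝ) {μ : ℂ} (hμ : ‖μ‖ = 1) :
    ∃ θ : ℝ, ∀ x : ℝ, Real.posLog (K * ‖circ x - μ‖)⁻¹ = glog K (x - θ) := by
  obtain ⟨θ, hθ⟩ : ∃ θ : ℝ, circ θ = μ := by
    refine ⟨Complex.arg μ / (2 * π), ?_⟩
    have h := Complex.norm_mul_exp_arg_mul_I μ
    rw [hμ, Complex.ofReal_one, one_mul] at h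
    unfold circ
    have hπ : (π : ℂ) ≠ 0 := Complex.ofReal_ne_zero.2 Real.pi_ne_zero
    rw [show (2 * π * Complex.I * ((Complex.arg μ / (2 * π) : ℝ) : ℂ) : ℂ) =
      Complex.arg μ * Complex.I by push_cast; field_simp]
    exact h
  refine ⟨θ, fun x => ?_⟩
  unfold glog
  rw [← hθ, show circ x - circ θ = circ θ * (circ (x - θ) - 1) by
    rw [mul_sub, mul_one, ← circ_add, show θ + (x - θ) = x by ring], norm_mul, norm_circ, one_mul]

/-- `x ↦ log⁺(1/(K|e(x) − μ|))` is locally integrable and `∫₀¹ ≤ 4/√K` (`|μ| = 1`, `K > 0`). [folklore] -/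
private theorem integral_posLog_inv_norm_sub_le {K : ℝ} (hK : 0 < K) {μ : ℂ} (hμ : ‖μ‖ = 1) :
    IntervalIntegrable (fun x => Real.posLog (K * ‖circ x - μ‖)⁻¹) volume 0 1 ∧
      ∫ x in (0 : ℝ)..1, Real.posLog (K * ‖circ x - μ‖)⁻¹ ≤ 4 * K ^ (-(1 / 2 : ℝ)) := by
  obtain ⟨θ, hθ⟩ := exists_rotation K hμ
  simp_rw [hθ]
  constructor
  · have h := (intervalIntegrable_glog hK (0 - θ) (1 - θ)).comp_sub_right θ
    simpa using h
  · rw [intervalIntegral.integral_comp_sub_right (glog K) θ, zero_sub,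
      show (1 : ℝ) - θ = -θ + 1 by ring, (glog_periodic K).intervalIntegral_add_eq (-θ) 0, zero_add]
    exact integral_glog_le hK

/-- **`h̃(A_N)` under a derivative lower bound**: if `log|A_N'(μ)| ≥ −L` at all roots, then for every
`K > 0`, `h̃(A_N) ≤ log⁺ e^L + log⁺ K + log d + 4d/√K` (`d = #rootSet N`). [folklore] -/
private theorem posLogMahlerMeasure_le_of_derivative_bound {N : ℕ} (hN : 1 ≤ N) {L K : ℝ}
    (hK : 0 < K)
    (hL : ∀ μ ∈ rootSet N, -L ≤ Real.log ‖eval μ (derivative (cyclotomicProduct N))‖) :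
    posLogMahlerMeasure (cyclotomicProduct N) ≤
      Real.posLog (Real.exp L) + Real.posLog K + Real.log (rootSet N).card +
        (rootSet N).card * (4 * K ^ (-(1 / 2 : ℝ))) := by
  have hI := intervalIntegrable_log_norm_eval N 0 1
  have hIpos : IntervalIntegrable (fun x => Real.posLog ‖eval (circ x) (cyclotomicProduct N)‖)
      volume 0 1 := by
    apply Continuous.intervalIntegrable
    unfold circ
    fun_prop
  have hstep1 : posLogMahlerMeasure (cyclotomicProduct N) =
      ∫ x in (0 : ℝ)..1, (Real.posLog ‖eval (circ x) (cyclotomicProduct N)‖ -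
        Real.log ‖eval (circ x) (cyclotomicProduct N)‖) := by
    rw [posLogMahlerMeasure, circleAverage_eq_integral_circ, intervalIntegral.integral_sub hIpos hI,
      integral_log_norm_eval_cyclotomicProduct, sub_zero]
  set c : ℝ := Real.posLog (Real.exp L) + Real.posLog K + Real.log (rootSet N).card with hc
  have hae : ∀ᵐ x : ℝ, Real.posLog ‖eval (circ x) (cyclotomicProduct N)‖ -
      Real.log ‖eval (circ x) (cyclotomicProduct N)‖ ≤
        c + ∑ μ ∈ rootSet N, Real.posLog (K * ‖circ x - μ‖)⁻¹ := by
    filter_upwards [ae_irrational] with x hx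
    have h := posLog_inv_norm_eval_le hN hK hL (fun μ hμ => circ_ne_of_mem_rootSet hx hμ)
    have hid : Real.posLog ‖eval (circ x) (cyclotomicProduct N)‖ -
        Real.log ‖eval (circ x) (cyclotomicProduct N)‖ =
        Real.posLog ‖eval (circ x) (cyclotomicProduct N)‖⁻¹ := by
      linarith [Real.posLog_sub_posLog_inv (x := ‖eval (circ x) (cyclotomicProduct N)‖)]
    rw [hid, hc]
    exact h
  have hG : ∀ μ ∈ rootSet N,
      IntervalIntegrable (fun x => Real.posLog (K * ‖circ x - μ‖)⁻¹) volume 0 1 ∧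
        ∫ x in (0 : ℝ)..1, Real.posLog (K * ‖circ x - μ‖)⁻¹ ≤ 4 * K ^ (-(1 / 2 : ℝ)) :=
    fun μ hμ => integral_posLog_inv_norm_sub_le hK (norm_eq_one_of_mem_rootSet hμ)
  have hGint : IntervalIntegrable
      (fun x => c + ∑ μ ∈ rootSet N, Real.posLog (K * ‖circ x - μ‖)⁻¹) volume 0 1 := by
    refine intervalIntegrable_const.add ?_
    have : (fun x => ∑ μ ∈ rootSet N, Real.posLog (K * ‖circ x - μ‖)⁻¹) =
        ∑ μ ∈ rootSet N, fun x => Real.posLog (K * ‖circ x - μ‖)⁻¹ := by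
      ext x; simp [Finset.sum_apply]
    rw [this]
    exact IntervalIntegrable.sum _ fun μ hμ => (hG μ hμ).1
  calc posLogMahlerMeasure (cyclotomicProduct N) = _ := hstep1
    _ ≤ ∫ x in (0 : ℝ)..1, (c + ∑ μ ∈ rootSet N, Real.posLog (K * ‖circ x - μ‖)⁻¹) :=
        intervalIntegral.integral_mono_ae zero_le_one (hIpos.sub hI) hGint hae
    _ = c + ∑ μ ∈ rootSet N, ∫ x in (0 : ℝ)..1, Real.posLog (K * ‖circ x - μ‖)⁻¹ := by
        rw [intervalIntegral.integral_add intervalIntegrable_const ?_, intervalIntegral.integral_const,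
          intervalIntegral.integral_finsetSum fun μ hμ => (hG μ hμ).1]
        · simp
        · have : (fun x => ∑ μ ∈ rootSet N, Real.posLog (K * ‖circ x - μ‖)⁻¹) =
              ∑ μ ∈ rootSet N, fun x => Real.posLog (K * ‖circ x - μ‖)⁻¹ := by
            ext x; simp [Finset.sum_apply]
          rw [this]
          exact IntervalIntegrable.sum _ fun μ hμ => (hG μ hμ).1
    _ ≤ c + ∑ μ ∈ rootSet N, 4 * K ^ (-(1 / 2 : ℝ)) := by
        gcongr with μ hμ; exact (hG μ hμ).2
    _ = c + (rootSet N).card * (4 * K ^ (-(1 / 2 : ℝ))) := by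
        rw [sum_const, nsmul_eq_mul]

/-- **`h̃(A_N) ≤ (|C| + 16) N^λ`** under `log|A_N'(ζ)| ≥ −C N^λ` at all roots of unity of order `≤ N`
(`N ≥ 1`, `λ ≥ 1/2`; take `K = N⁴`). [folklore] -/
private theorem posLogMahlerMeasure_le_of_derivative_criterion {lam C : ℝ} (h0 : 1 / 2 ≤ lam)
    {N : ℕ} (hN : 1 ≤ N)
    (hC : ∀ z : ℂ, (∃ m : ℕ, 1 ≤ m ∧ m ≤ N ∧ z ^ m = 1) →
      -C * (N : ℝ) ^ lam ≤ Real.log ‖eval z (derivative (cyclotomicProduct N))‖) :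
    posLogMahlerMeasure (cyclotomicProduct N) ≤ (|C| + 16) * (N : ℝ) ^ lam := by
  have hN' : (1 : ℝ) ≤ N := by exact_mod_cast hN
  have hN0 : (0 : ℝ) < N := by linarith
  set K : ℝ := (N : ℝ) ^ (4 : ℝ) with hK
  have hK0 : 0 < K := Real.rpow_pos_of_pos hN0 _
  have hK1 : 1 ≤ K := Real.one_le_rpow hN' (by norm_num)
  have hL : ∀ μ ∈ rootSet N, -(C * (N : ℝ) ^ lam) ≤
      Real.log ‖eval μ (derivative (cyclotomicProduct N))‖ := fun μ hμ => by
    have := hC μ (pow_eq_one_of_mem_rootSet hμ); linarith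
  have hmain := posLogMahlerMeasure_le_of_derivative_bound hN hK0 hL
  have hNl : 1 ≤ (N : ℝ) ^ lam := Real.one_le_rpow hN' (by linarith)
  -- log N ≤ 2 N^{1/2} ≤ 2 N^λ
  have hlogN : Real.log N ≤ 2 * (N : ℝ) ^ lam := by
    have h1 := Real.log_le_rpow_div hN0.le (by norm_num : (0 : ℝ) < 1 / 2)
    have h2 : (N : ℝ) ^ (1 / 2 : ℝ) ≤ (N : ℝ) ^ lam := Real.rpow_le_rpow_of_exponent_le hN' h0
    have : (N : ℝ) ^ (1 / 2 : ℝ) / (1 / 2) = 2 * (N : ℝ) ^ (1 / 2 : ℝ) := by ring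
    linarith
  -- the four terms
  have t1 : Real.posLog (Real.exp (C * (N : ℝ) ^ lam)) ≤ |C| * (N : ℝ) ^ lam := by
    rw [Real.posLog_apply, Real.log_exp, max_le_iff]
    exact ⟨by positivity, mul_le_mul_of_nonneg_right (le_abs_self C) (by positivity)⟩
  have t2 : Real.posLog K ≤ 8 * (N : ℝ) ^ lam := by
    rw [Real.posLog_eq_log (by rw [abs_of_pos hK0]; exact hK1), hK, Real.log_rpow hN0]
    linarith
  have hcard := card_rootSet_le N
  have hcard1 : 1 ≤ (rootSet N).card := Finset.card_pos.2 ⟨1, one_mem_rootSet hN⟩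
  have hcardR : ((rootSet N).card : ℝ) ≤ (N : ℝ) * N := by exact_mod_cast hcard
  have t3 : Real.log (rootSet N).card ≤ 4 * (N : ℝ) ^ lam := by
    have h1 : Real.log (rootSet N).card ≤ Real.log ((N : ℝ) * N) :=
      Real.log_le_log (by exact_mod_cast hcard1) hcardR
    rw [Real.log_mul hN0.ne' hN0.ne'] at h1
    linarith
  have t4 : ((rootSet N).card : ℝ) * (4 * K ^ (-(1 / 2 : ℝ))) ≤ 4 * (N : ℝ) ^ lam := by
    have hKr : K ^ (-(1 / 2 : ℝ)) = ((N : ℝ) * N)⁻¹ := by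
      rw [hK, ← Real.rpow_mul hN0.le, show (4 : ℝ) * (-(1 / 2)) = -2 by norm_num,
        Real.rpow_neg hN0.le, Real.rpow_two, sq]
    rw [hKr]
    have hNN : 0 < (N : ℝ) * N := by positivity
    have h1 : ((rootSet N).card : ℝ) * (4 * ((N : ℝ) * N)⁻¹) ≤
        ((N : ℝ) * N) * (4 * ((N : ℝ) * N)⁻¹) :=
      mul_le_mul_of_nonneg_right hcardR (by positivity)
    have h2 : ((N : ℝ) * N) * (4 * ((N : ℝ) * N)⁻¹) = 4 := by field_simp
    linarith
  calc posLogMahlerMeasure (cyclotomicProduct N) ≤ _ := hmain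
    _ ≤ |C| * (N : ℝ) ^ lam + 8 * (N : ℝ) ^ lam + 4 * (N : ℝ) ^ lam + 4 * (N : ℝ) ^ lam := by
        gcongr
    _ = (|C| + 16) * (N : ℝ) ^ lam := by ring

end AmorosoProofs

/-- **DISCHARGE of the named fact `Amoroso1995_derivative_criterion`** (Broughan Vol. 2 **Thm 7.7**;
Amoroso, Rend. Sem. Mat. Univ. Politec. Torino 53 (1995), second theorem, Zbl 0879.11011): for
`1/2 ≤ λ < 1`, a uniform lower bound `log|A_N'(ζ)| ≥ −C N^λ` at all roots of unity `ζ` of order `≤ N`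
implies `ζ(s) ≠ 0` on `Re s > λ`. PROVED (standard axioms); route (the 1995 source is not held):
Lagrange interpolation at the roots of `A_N` turns the derivative bound into
`h̃(A_N) ≤ (|C| + 16) N^λ` (`AmorosoProofs.posLogMahlerMeasure_le_of_derivative_criterion`), and the
`⟹` half of the Amoroso criterion (`zeroFree_of_posLogMahlerMeasure_isBigO`, §9) concludes.
[cite: Broughan2017, Vol. 2 Thm 7.7 p. 117; Amoroso1995, second theorem (Zbl 0879.11011)] -/
theorem Amoroso1995_derivative_criterion_holds : Amoroso1995_derivative_criterion := by
  intro lam h0 _ hC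
  obtain ⟨C, hC⟩ := hC
  apply AmorosoProofs.zeroFree_of_posLogMahlerMeasure_isBigO h0
  intro ε hε
  refine IsBigO.of_bound (|C| + 16) (eventually_atTop.2 ⟨1, fun N hN => ?_⟩)
  have hN' : (1 : ℝ) ≤ N := by exact_mod_cast hN
  have hN0 : (0 : ℝ) < N := by linarith
  rw [Real.norm_of_nonneg (AmorosoProofs.posLogMahlerMeasure_cyclotomicProduct_nonneg N),
    Real.norm_of_nonneg (by positivity)]
  calc posLogMahlerMeasure (cyclotomicProduct N) ≤ (|C| + 16) * (N : ℝ) ^ lam :=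
        AmorosoProofs.posLogMahlerMeasure_le_of_derivative_criterion h0 hN (hC N hN)
    _ ≤ (|C| + 16) * (N : ℝ) ^ (lam + ε) :=
        mul_le_mul_of_nonneg_left (Real.rpow_le_rpow_of_exponent_le hN' (by linarith))
          (by positivity)

/-- **Thm 7.7 at `λ = 1/2`, unconditional form**: the derivative lower bound `log|A_N'(ζ)| ≥ −C √N` at all
roots of unity of order `≤ N` implies the Riemann hypothesis (the tree's
`Amoroso1995_derivative_criterion.riemannHypothesis` fed with the discharge).
[cite: Broughan2017, Vol. 2 Thm 7.7 (case λ = 1/2)] -/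
theorem riemannHypothesis_of_cyclotomicProduct_derivative_bound
    (hC : ∃ C : ℝ, ∀ N : ℕ, 1 ≤ N → ∀ z : ℂ, (∃ m : ℕ, 1 ≤ m ∧ m ≤ N ∧ z ^ m = 1) →
      -C * (N : ℝ) ^ (1 / 2 : ℝ) ≤ Real.log ‖eval z (derivative (cyclotomicProduct N))‖) :
    RiemannHypothesis :=
  Amoroso1995_derivative_criterion_holds.riemannHypothesis hC

namespace AmorosoProofs

/-! ### §11. `J₁₁ = π²/12` by Parseval, and Amoroso's conjugate-function identity in `L²`:
`∫₀¹ (log|A_N(e(x))|)² dx = π² ∫₀¹ G_N(x)² dx` with Franel's `G_N(x) = ∑_{k≤N} M(N/k) B̄₁(kx)`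
(Amoroso §5: "the conjugate of `r(t) = log|R(e^{it})|` is `π ψ(t/2π)`"); hence the bridge to the
Franel–Landau row `h̃(A_N)² ≤ (π²/4)(A(N) Σ_ν δ_ν² + 1/12)`. The Fourier coefficients of `v` are
`v̂(0) = 0` (`m(X − 1) = 0`) and `v̂(n) = −1/(2|n|)` (`n ≠ 0`; from `∫₀¹ v cos 2πx = −1/2` of §7 and the
dilation identity `v(nx) = ∑_{j<n} v(x + j/n)` of §2 — no radial limits needed). -/

/-- `A_1 = X − 1`. [folklore] -/
private theorem cyclotomicProduct_one : cyclotomicProduct 1 = X - 1 := by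
  simp [cyclotomicProduct]

/-- `∫₀¹ v = 0` (`m(X − 1) = 0`). [folklore] -/
private theorem integral_vlog_eq_zero : ∫ x in (0 : ℝ)..1, vlog x = 0 := by
  have h := integral_log_norm_eval_cyclotomicProduct 1
  simpa [cyclotomicProduct_one, vlog] using h

/-- `v(1 − x) = v(x)`. [folklore] -/
private theorem vlog_one_sub (x : ℝ) : vlog (1 - x) = vlog x := by
  rw [vlog_eq_log_sin, vlog_eq_log_sin, show π * (1 - x) = π - π * x by ring, Real.sin_pi_sub]

/-- `∫₀¹ v(x) cos(2πnx) dx = −1/(2n)` for `n ≥ 1` (the `n`-th cosine coefficient of `log|1 − e^{2πix}|`).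
[folklore] -/
private theorem integral_vlog_mul_cos_nat {n : ℕ} (hn : 1 ≤ n) :
    ∫ x in (0 : ℝ)..1, vlog x * Real.cos (2 * π * n * x) = -1 / (2 * n) := by
  have hn0 : (n : ℝ) ≠ 0 := by positivity
  -- (1) `∫₀¹ v(nx) cos(2πnx) dx = ∫₀¹ v(u) cos(2πu) du = -1/2`
  have h1 : ∫ x in (0 : ℝ)..1, vlog (n * x) * Real.cos (2 * π * n * x) = -1 / 2 := by
    have h := integral_comp_natMul_of_periodic (G := fun u => vlog u * Real.cos (2 * π * u))
      (fun t k => by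
        show vlog (t + k) * Real.cos (2 * π * (t + k)) = vlog t * Real.cos (2 * π * t)
        rw [vlog_add_nat, mul_add, show 2 * π * (k : ℝ) = (k : ℕ) * (2 * π) by ring,
          Real.cos_add_nat_mul_two_pi])
      (fun s t => (intervalIntegrable_vlog s t).mul_continuousOn
        (Continuous.continuousOn (by fun_prop))) hn
    have e : (fun x => vlog (n * x) * Real.cos (2 * π * n * x)) =
        fun x => vlog ((n : ℝ) * x) * Real.cos (2 * π * ((n : ℝ) * x)) := by
      ext x; ring_nf
    rw [e, h, integral_vlog_mul_cos]
  -- (2) `∫₀¹ v(nx) cos(2πnx) dx = n ∫₀¹ v(x) cos(2πnx) dx` via `v(nx) = Σ_j v(x + j/n)` a.e.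
  have hH : ∀ j : ℕ, ∀ x : ℝ, vlog (x + (1 * j : ℕ) / (n : ℝ)) * Real.cos (2 * π * n * x) =
      (fun y => vlog y * Real.cos (2 * π * n * y)) (x + (1 * j : ℕ) / (n : ℝ)) := by
    intro j x
    simp only
    congr 1
    rw [mul_add, show 2 * π * (n : ℝ) * ((1 * j : ℕ) / (n : ℝ)) = (j : ℕ) * (2 * π) by
      push_cast; field_simp, Real.cos_add_nat_mul_two_pi]
  have hper : Function.Periodic (fun y => vlog y * Real.cos (2 * π * n * y)) 1 := fun y => by
    simp only
    rw [vlog_periodic, mul_add, mul_one, show 2 * π * (n : ℝ) = (n : ℕ) * (2 * π) by ring,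
      Real.cos_add_nat_mul_two_pi]
  have hint : ∀ s t : ℝ, IntervalIntegrable (fun y => vlog y * Real.cos (2 * π * n * y)) volume s t :=
    fun s t => (intervalIntegrable_vlog s t).mul_continuousOn (Continuous.continuousOn (by fun_prop))
  have hterm : ∀ j ∈ range n, ∫ x in (0 : ℝ)..1, vlog (x + (1 * j : ℕ) / (n : ℝ)) *
      Real.cos (2 * π * n * x) = ∫ x in (0 : ℝ)..1, vlog x * Real.cos (2 * π * n * x) := by
    intro j _
    simp_rw [hH j]
    rw [intervalIntegral.integral_comp_add_right (fun y => vlog y * Real.cos (2 * π * n * y))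
      ((1 * j : ℕ) / (n : ℝ)), zero_add,
      show (1 : ℝ) + (1 * j : ℕ) / (n : ℝ) = (1 * j : ℕ) / (n : ℝ) + 1 by ring]
    have := hper.intervalIntegral_add_eq ((1 * j : ℕ) / (n : ℝ)) 0
    rw [zero_add] at this
    exact this
  have h2 : ∫ x in (0 : ℝ)..1, vlog (n * x) * Real.cos (2 * π * n * x) =
      n * ∫ x in (0 : ℝ)..1, vlog x * Real.cos (2 * π * n * x) := by
    have hae : ∀ᵐ x : ℝ, vlog (n * x) * Real.cos (2 * π * n * x) =
        ∑ j ∈ range n, vlog (x + (1 * j : ℕ) / (n : ℝ)) * Real.cos (2 * π * n * x) := by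
      filter_upwards [ae_irrational] with x hx
      rw [← sum_mul, sum_vlog_add_mul_div hn (Nat.coprime_one_right n) hx]
    rw [integral_congr_ae (hae.mono fun x hx _ => hx), intervalIntegral.integral_finsetSum]
    · rw [sum_congr rfl hterm, sum_const, card_range, nsmul_eq_mul]
    · intro j _
      simp_rw [hH j]
      have := (hint (0 + (1 * j : ℕ) / (n : ℝ)) (1 + (1 * j : ℕ) / (n : ℝ))).comp_add_right
        ((1 * j : ℕ) / (n : ℝ))
      simpa using this
  rw [h2] at h1
  field_simp at h1 ⊢
  linarith

/-- `∫₀¹ v(x) sin(2πnx) dx = 0` (`v(1 − x) = v(x)`). [folklore] -/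
private theorem integral_vlog_mul_sin (n : ℤ) :
    ∫ x in (0 : ℝ)..1, vlog x * Real.sin (2 * π * n * x) = 0 := by
  set I := ∫ x in (0 : ℝ)..1, vlog x * Real.sin (2 * π * n * x) with hI
  have h := intervalIntegral.integral_comp_sub_left (fun x => vlog x * Real.sin (2 * π * n * x))
    (1 : ℝ) (a := 0) (b := 1)
  simp only [sub_self, sub_zero] at h
  have hpt : ∀ x : ℝ, vlog (1 - x) * Real.sin (2 * π * n * (1 - x)) =
      -(vlog x * Real.sin (2 * π * n * x)) := by
    intro x
    rw [vlog_one_sub, mul_sub, mul_one, show 2 * π * (n : ℝ) = (n : ℤ) * (2 * π) by ring,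
      Real.sin_int_mul_two_pi_sub]
    ring
  simp_rw [hpt, intervalIntegral.integral_neg] at h
  rw [← hI] at h
  linarith

/-- **The Fourier coefficients of `v = log|1 − e^{2πix}|`**: `v̂(0) = 0`, `v̂(n) = −1/(2|n|)` (`n ≠ 0`),
i.e. `log|1 − e^{it}| = −∑_{k≥1} cos(kt)/k` in `L²`. [folklore] -/
private theorem fourierCoeffOn_vlog (n : ℤ) :
    fourierCoeffOn zero_lt_one (fun x => (vlog x : ℂ)) n =
      (((-1 : ℝ) / (2 * (n.natAbs : ℝ)) : ℝ) : ℂ) := by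
  rw [fourierCoeffOn_eq_integral]
  simp only [sub_zero, div_one, one_smul]
  have hexp : ∀ x : ℝ, (fourier (-n) (x : AddCircle ((1 : ℝ) - 0))) • ((vlog x : ℝ) : ℂ) =
      (((vlog x * Real.cos (2 * π * n * x) : ℝ) : ℂ)) -
        Complex.I * (((vlog x * Real.sin (2 * π * n * x) : ℝ) : ℂ)) := by
    intro x
    rw [fourier_coe_apply, smul_eq_mul]
    rw [show (2 * π * Complex.I * ((-n : ℤ) : ℂ) * (x : ℂ) / ((1 : ℝ) - 0 : ℝ) : ℂ) =
      ((-(2 * π * n * x) : ℝ) : ℂ) * Complex.I by push_cast; ring, Complex.exp_mul_I]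
    push_cast
    rw [Complex.cos_neg, Complex.sin_neg]
    ring
  simp_rw [hexp]
  have hr1 : IntervalIntegrable (fun x => vlog x * Real.cos (2 * π * n * x)) volume 0 1 :=
    (intervalIntegrable_vlog 0 1).mul_continuousOn (Continuous.continuousOn (by fun_prop))
  have hr2 : IntervalIntegrable (fun x => vlog x * Real.sin (2 * π * n * x)) volume 0 1 :=
    (intervalIntegrable_vlog 0 1).mul_continuousOn (Continuous.continuousOn (by fun_prop))
  have hi1 : IntervalIntegrable (fun x => (((vlog x * Real.cos (2 * π * n * x) : ℝ) : ℂ)))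
      volume 0 1 := ⟨hr1.1.ofReal, hr1.2.ofReal⟩
  have hi2' : IntervalIntegrable (fun x => (((vlog x * Real.sin (2 * π * n * x) : ℝ) : ℂ)))
      volume 0 1 := ⟨hr2.1.ofReal, hr2.2.ofReal⟩
  have hi2 : IntervalIntegrable (fun x => Complex.I * (((vlog x * Real.sin (2 * π * n * x) : ℝ) : ℂ)))
      volume 0 1 := hi2'.const_mul _
  rw [intervalIntegral.integral_sub hi1 hi2, intervalIntegral.integral_const_mul,
    intervalIntegral.integral_ofReal, intervalIntegral.integral_ofReal, integral_vlog_mul_sin]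
  simp only [Complex.ofReal_zero, mul_zero, sub_zero]
  congr 1
  -- the cosine coefficient
  rcases eq_or_ne n 0 with hn | hn
  · subst hn
    simp only [Int.cast_zero, mul_zero, zero_mul, Real.cos_zero, mul_one, Int.natAbs_zero,
      Nat.cast_zero, div_zero]
    exact integral_vlog_eq_zero
  · have hN : 1 ≤ n.natAbs := Nat.one_le_iff_ne_zero.2 (Int.natAbs_ne_zero.2 hn)
    have hcos : ∀ x : ℝ, Real.cos (2 * π * n * x) = Real.cos (2 * π * (n.natAbs : ℕ) * x) := by
      intro x
      rcases Int.natAbs_eq n with h | h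
      · conv_lhs => rw [h]
        simp
      · conv_lhs => rw [h]
        simp [Real.cos_neg, neg_mul, mul_neg]
    simp_rw [hcos]
    rw [integral_vlog_mul_cos_nat hN]

/-- `v ∈ L²(0,1)` (complex-valued form). [folklore] -/
private theorem memLp_vlog : MemLp (fun x => (vlog x : ℂ)) 2 (volume.restrict (Set.Ioc 0 1)) := by
  rw [memLp_two_iff_integrable_sq_norm (f := fun x => (vlog x : ℂ))
    (by exact (Complex.measurable_ofReal.comp measurable_vlog).aestronglyMeasurable)]
  have h := (intervalIntegrable_iff_integrableOn_Ioc_of_le zero_le_one).1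
    (intervalIntegrable_vlog_sq 0 1)
  refine h.congr (ae_of_all _ fun x => ?_)
  simp [Complex.norm_real, sq_abs]

/-- **`J₁₁ = ∫₀¹ log²|1 − e^{2πix}| dx = π²/12`**, i.e. the second higher Mahler measure
`m₂(x − 1) = ζ(2)/2 = π²/12` (Kurokawa–Lalín–Ochiai; here by Parseval for
`log|1 − e(x)| = −Σ_{n≥1} cos(2πnx)/n`: `2 Σ_{n≥1} 1/(4n²) = π²/12`).
[cite: KurokawaLalinOchiai2009, §1 and §3 Examples 5 (m₂(1 − x) = ζ(2)/2 = π²/12)] -/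
theorem J_one_one_eq : J 1 1 = π ^ 2 / 12 := by
  have hP := tsum_sq_fourierCoeffOn zero_lt_one memLp_vlog
  have hR : ((1 : ℝ) - 0)⁻¹ • ∫ x in (0 : ℝ)..1, ‖(vlog x : ℂ)‖ ^ 2 = J 1 1 := by
    rw [sub_zero, inv_one, one_smul, J]
    refine integral_congr fun x _ => ?_
    simp [Complex.norm_real, sq]
  set f : ℤ → ℝ := fun i => 1 / 4 * (1 / ((i.natAbs : ℕ) : ℝ) ^ 2) with hf
  have hcoef : ∀ i : ℤ, ‖fourierCoeffOn zero_lt_one (fun x => (vlog x : ℂ)) i‖ ^ 2 = f i := by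
    intro i
    rw [fourierCoeffOn_vlog, Complex.norm_real, Real.norm_eq_abs, abs_div, abs_neg, abs_one,
      abs_of_nonneg (by positivity), hf]
    ring
  simp_rw [hcoef] at hP
  -- sum over ℤ = two copies of `(1/4) ζ(2)`
  have hpos : HasSum (fun k : ℕ => f k) (1 / 4 * (π ^ 2 / 6)) := by
    have e : (fun k : ℕ => f k) = fun k : ℕ => 1 / 4 * (1 / (k : ℝ) ^ 2) := by
      ext k; simp [hf]
    rw [e]
    exact hasSum_zeta_two.mul_left (1 / 4)
  have hneg : HasSum (fun k : ℕ => f (-((k : ℤ) + 1))) (1 / 4 * (π ^ 2 / 6)) := by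
    have e : (fun k : ℕ => f (-((k : ℤ) + 1))) = fun k : ℕ => 1 / 4 * (1 / ((k + 1 : ℕ) : ℝ) ^ 2) := by
      ext k
      simp only [hf, Int.natAbs_neg]
      rw [show ((k : ℤ) + 1) = ((k + 1 : ℕ) : ℤ) by push_cast; ring, Int.natAbs_natCast]
    rw [e]
    have h := (hasSum_nat_add_iff' (f := fun m : ℕ => 1 / 4 * (1 / (m : ℝ) ^ 2)) 1).2
      (hasSum_zeta_two.mul_left (1 / 4))
    simpa using h
  have hZ := HasSum.of_nat_of_neg_add_one hpos hneg
  rw [← hR, ← hP, hZ.tsum_eq]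
  ring

/-- **Amoroso's conjugate-function identity in `L²`** (internal form):
`∫₀¹ g_N² = π² ∫₀¹ G_N²` with `G_N(x) = ∑_{k≤N} M(N/k) B̄₁(kx)` Franel's function. [folklore] -/
private theorem integral_gsum_sq_eq_pi_sq_mul (n : ℕ) :
    ∫ x in (0 : ℝ)..1, gsum n x ^ 2 =
      π ^ 2 * ∫ u in (0 : ℝ)..1, (∑ k ∈ Icc 1 n, (mertensFunction ((n : ℝ) / k) : ℝ) *
        FareyFranel.sawtooth ((k : ℝ) * u)) ^ 2 := by
  rw [integral_gsum_sq, FareyFranel.integral_sq_sum_mertens_sawtooth, J_one_one_eq, mul_sum]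
  refine sum_congr rfl fun a _ => ?_
  rw [mul_sum]
  refine sum_congr rfl fun b _ => ?_
  ring

end AmorosoProofs

open AmorosoProofs in
/-- **Amoroso's conjugate-function identity, `L²` form** (Amoroso §5: "an elementary geometrical
argument shows that the conjugate of `u(t) = log|1 − e^{it}|` is `π v(t/2π)`, thus by linearity the
conjugate of `r(t) = log|Φ(e^{it})|` is `π ψ(t/2π)`", `ψ` the Farey discrepancy sum; conjugation is an
`L²`-isometry on mean-zero functions): with `A_N = Φ₁⋯Φ_N` and Franel's function
`G_N(x) = ∑_{k ≤ N} M(N/k) B̄₁(kx) = ∑_{r ∈ F_N} B̄₁(x + r)` (tree `FareyFranel.sum_fareyFractions_sawtooth_eq`),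
`∫₀¹ (log|A_N(e^{2πix})|)² dx = π² ∫₀¹ G_N(x)² dx`. PROVED without conjugate functions: both sides are
Gram sums over the Möbius side, `J_{ab} = (a,b)² J₁₁/(ab)` (§3) against Franel's
`I_{ab} = (a,b)²/(12ab)` (Edwards §12.2, tree), and `J₁₁ = π²/12` (§11, Parseval).
[cite: Amoroso1996, §5 (the conjugate of r(t) is πψ(t/2π)); Edwards1974, §12.2 (I_{ab} = c²/12ab)] -/
theorem integral_sq_log_norm_cyclotomicProduct_eq (N : ℕ) :
    ∫ x in (0 : ℝ)..1, Real.log ‖eval (Complex.exp (2 * π * Complex.I * x)) (cyclotomicProduct N)‖ ^ 2 =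
      π ^ 2 * ∫ u in (0 : ℝ)..1, (∑ k ∈ Icc 1 N, (mertensFunction ((N : ℝ) / k) : ℝ) *
        FareyFranel.sawtooth ((k : ℝ) * u)) ^ 2 := by
  rw [← integral_gsum_sq_eq_pi_sq_mul]
  refine integral_congr_ae ?_
  filter_upwards [ae_log_norm_eval_eq_gsum N] with x hx _
  rw [← hx]
  rfl

open AmorosoProofs in
/-- **The Amoroso–Franel bridge**: for `N ≥ 1`,
`h̃(Φ₁⋯Φ_N)² ≤ (π²/4) · (A(N) ∑_ν δ_ν² + 1/12)`, `A(N) = #F_N`, `δ_ν` the Franel–Landau deviations of the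
Farey fractions of order `N` (`h̃(A_N) = ½‖log|A_N|‖₁ ≤ ½‖log|A_N|‖₂ = (π/2)‖G_N‖₂` and Franel's
`∫₀¹ G_N² = A ∑ δ_ν² + 1/12`, tree `FareyFranel.card_mul_sum_fareyDeviation_sq_eq`). Amoroso §4–§5:
"the value of the `L¹` norm of the local discrepancy of the Farey sequence is closely related to the
Riemann Hypothesis … `h̃_p` and the local discrepancy of the distribution of the zeros".
[cite: Amoroso1996, §5 ((5.3) via Huxley/Franel); Edwards1974, §12.2 (I = AΣδ² + 1/12)] -/
theorem posLogMahlerMeasure_sq_le_franel {N : ℕ} (hN : 1 ≤ N) :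
    posLogMahlerMeasure (cyclotomicProduct N) ^ 2 ≤
      π ^ 2 / 4 * (((fareyFractions N).card : ℝ) * ∑ r ∈ fareyFractions N, fareyDeviation N r ^ 2 +
        1 / 12) := by
  rw [posLogMahlerMeasure_cyclotomicProduct_eq, mul_pow, FareyFranel.card_mul_sum_fareyDeviation_sq_eq hN,
    sub_add_cancel]
  have h1 := sq_integral_abs_le_integral_sq (intervalIntegrable_gsum N 0 1)
    (intervalIntegrable_gsum_sq N 0 1)
  rw [integral_gsum_sq_eq_pi_sq_mul] at h1
  nlinarith [h1]

end Literature.NumberTheory.LFunctions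

end
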